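import Mathlib.Analysis.SpecialFunctions.Complex.Log
import Mathlib.RingTheory.Algebraic.Integral
import Literature.NumberTheory.Transcendental.ExpPointsExamples
import Literature.NumberTheory.Transcendental.ZariskiDimBounds
import Literature.NumberTheory.Transcendental.LindemannWeierstrassProofs
import HarnessLib

/-!
# Sparsity at `n = 2`: two open cubic atoms (root chain; double Cayley)

Companion of `ExpPointsExamples.lean` (load-bearing hypotheses) and `ExpPointsShapiroModel.lean`
(Hermite–Lindemann and the √2 Shapiro model pair). Write SPARSITY(2) for "every `W ⊆ ℂ² × ℂ²`
defined over ℚ with `zariskiDim ℂ W < 2` has finitely many ℚ-linearly independent exponential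
points" (`indepExpPoints W` finite; EMPTY under Schanuel's conjecture at `n = 2`; the crux
`SparsityTwo` of the Schanuel routes, taken here as the hypothesis `h` verbatim — no conjecture is
asserted). This file feeds two explicit ℚ-curves of degree 3 into SPARSITY(2), chosen so that the
resulting finiteness statements are OPEN coincidence problems not covered by any printed theorem
(they are not Ritt exponential polynomials, so Shapiro-type results — van der Poorten–Tijdeman for
simple pairs, D'Aquino–Macintyre–Terzo 2014 under SC — do not apply; Schanuel at `n = 2` settles
both since `trdeg ℚ(t, t³, eᵗ, e^{t³}) = trdeg ℚ(t)` at a hit):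

* `rootChain_finite_of_sparsity` — the ROOT-CHAIN curve `{x₂ = x₁³, y₂ = 1, (1−x₁)(y₁+1) = 2}`:
  SPARSITY(2) ⇒ `eᵗ = (1+t)/(1−t)` has finitely many solutions with `t³ ∈ 2πiℤ ∖ {0}`. The imaginary
  cube root `t = iθ`, `θ³ = ∓2π|n|`, hits iff `θ − 2arctan θ ∈ 2πℤ`; with `θ = πM − 2/θ + O(θ⁻³)`
  (`M` odd) this reads `n = ∓(π²M³/2 − 3M + 1/(π²M) + O(M⁻³))`, an exact Weyl-cubic coincidence for
  `π²` with non-vanishing first-order term.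
* `cubicCayley_finite_of_sparsity` — the DOUBLE-CAYLEY cubic curve
  `{x₂ = x₁³, (1−x₁)(y₁+1) = 2, (1−x₂)(y₂+1) = 2}`: SPARSITY(2) ⇒ `(1−t)eᵗ = 1+t`,
  `(1−t³)e^{t³} = 1+t³` have finitely many common solutions `t ≠ 0` (hit condition on the axis:
  `‖π²M³/2 − 1/2 + 1/(π²M) + O(M⁻³)‖ = 0`).

Dimension certificates: every coordinate is exhibited integral over `ℂ[u]` (`u = x₁ + y₁` resp.
`x₁ + y₁ + y₂`) by an explicit monic relation (quadratics; quartics — the `x₂`-quartic is the cubic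
resultant `E³ + YF³ + Y²G³ − 3YEFG` of the `x₁`-quartic with `Y − X³`, the `y`-quartics are
`T⁴m(1 − 2/T)/m(1)`) with ideal-membership certificates checked by `linear_combination`
(`zariskiDim_le_of_integral_gens`). ℚ-independence of `(t, t³)` at hits: from `π² ∉ ℚ`
(`transcendental_pi_holds`) resp. Hermite–Lindemann (`transcendental_exp_holds`), both PROVED in
the tree. Everything is sorry-free; no named fact is introduced.

## References
* P. D'Aquino, A. Macintyre, G. Terzo, *From Schanuel's conjecture to Shapiro's conjecture*,
  Comment. Math. Helv. 89 (2014) 597–616, §§3, 5 (scope of the known Shapiro-type finiteness).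
* D. Marker, *A remark on Zilber's pseudoexponentiation*, J. Symb. Logic 71 (2006), §1 (ℚ-varieties,
  dimension, genericity in `ℂⁿ × (ℂˣ)ⁿ`).
-/

namespace Literature.NumberTheory.Transcendental

open MvPolynomial Complex
open scoped Real

noncomputable section

/-! ## The root-chain curve `{x₂ = x₁³, y₂ = 1, (1 − x₁)(y₁ + 1) = 2}`
Hits: `t³ = 2πin`, `n ≠ 0`, and `eᵗ = (1+t)/(1−t)`. The two non-imaginary cube roots have
`|Re t| = (2π|n|)^{1/3}cos(π/6) → ∞` against `|(1+t)/(1−t)| → 1`: finitely many. The imaginary root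
`t = iθ`, `θ = ∓(2π|n|)^{1/3}`, hits iff `θ − 2arctan θ ∈ 2πℤ` (depth-1 Weyl-cubic target for `π²`,
see the module docstring). -/

/-- The root-chain curve `W = {x₂ = x₁³, y₂ = 1, (1 − x₁)(y₁ + 1) = 2}` ⊆ ℂ² × ℂ². [folklore] -/
def rootChainW : Set (Fin 2 ⊕ Fin 2 → ℂ) :=
  {w | w (Sum.inl 1) = w (Sum.inl 0) ^ 3 ∧ w (Sum.inr 1) = 1 ∧
    (1 - w (Sum.inl 0)) * (w (Sum.inr 0) + 1) = 2}

/-- `rootChainW` is defined over the prime field. [folklore] -/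
theorem isDefinedOver_rootChainW : IsDefinedOver (⊥ : Subfield ℂ) rootChainW := by
  refine ⟨Ideal.span {X (Sum.inl 1) - X (Sum.inl 0) ^ 3, X (Sum.inr 1) - 1,
    (1 - X (Sum.inl 0)) * (X (Sum.inr 0) + 1) - 2}, ?_⟩
  ext w
  simp only [rootChainW, Set.mem_setOf_eq, zeroLocus_span, Set.mem_insert_iff,
    Set.mem_singleton_iff, forall_eq_or_imp, forall_eq, map_sub, map_mul, map_add, map_pow,
    aeval_X, map_one, map_ofNat, sub_eq_zero]

section rootChainCerts
variable (x₁ x₂ y₁ y₂ : ℂ) (h1 : x₂ = x₁ ^ 3) (h2 : y₂ = 1) (h3 : (1 - x₁) * (y₁ + 1) = 2)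
include h3

/-- `x₁` is a root of `T² − (u+2)T + (u−1)`, `u = x₁ + y₁`, on `rootChainW`. [folklore] -/
theorem rootChainW_cert_x₁ : x₁ ^ 2 - ((x₁ + y₁) + 2) * x₁ + ((x₁ + y₁) - 1) = 0 := by
  linear_combination h3

/-- `y₁` is a root of `T² + (2−u)T − (u+1)` on `rootChainW`. [folklore] -/
theorem rootChainW_cert_y₁ : y₁ ^ 2 + (2 - (x₁ + y₁)) * y₁ - ((x₁ + y₁) + 1) = 0 := by
  linear_combination h3

include h1 in
/-- `x₂` is a root of `T² − sT + (u−1)³`, `s = (u+2)³ − 3(u+2)(u−1)`, on `rootChainW`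
(quotient certificate `Q = x₁⁴ + σx₁³ + (σ²−π)x₁² + σπx₁ + π²`, `σ = u+2`, `π = u−1`). [folklore] -/
theorem rootChainW_cert_x₂ :
    x₂ ^ 2 - (((x₁ + y₁) + 2) ^ 3 - 3 * ((x₁ + y₁) + 2) * ((x₁ + y₁) - 1)) * x₂ +
      ((x₁ + y₁) - 1) ^ 3 = 0 := by
  linear_combination
    (x₂ + x₁ ^ 3 - (((x₁ + y₁) + 2) ^ 3 - 3 * ((x₁ + y₁) + 2) * ((x₁ + y₁) - 1))) * h1 +
    (x₁ ^ 4 + ((x₁ + y₁) + 2) * x₁ ^ 3 + (((x₁ + y₁) + 2) ^ 2 - ((x₁ + y₁) - 1)) * x₁ ^ 2 +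
      ((x₁ + y₁) + 2) * ((x₁ + y₁) - 1) * x₁ + ((x₁ + y₁) - 1) ^ 2) * h3

end rootChainCerts

/-- Monic quadratic over `ℂ[u]` killing `x₁` on `rootChainW`. [folklore] -/
def rootChainPolyX₁ : Polynomial (MvPolynomial (Fin 1) ℂ) :=
  Polynomial.X ^ 2 + Polynomial.C (-(X 0 + 2)) * Polynomial.X + Polynomial.C (X 0 - 1)

/-- Monic quadratic over `ℂ[u]` killing `y₁` on `rootChainW`. [folklore] -/
def rootChainPolyY₁ : Polynomial (MvPolynomial (Fin 1) ℂ) :=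
  Polynomial.X ^ 2 + Polynomial.C (2 - X 0) * Polynomial.X + Polynomial.C (-(X 0 + 1))

/-- Monic quadratic over `ℂ[u]` killing `x₂` on `rootChainW`. [folklore] -/
def rootChainPolyX₂ : Polynomial (MvPolynomial (Fin 1) ℂ) :=
  Polynomial.X ^ 2 + Polynomial.C (-((X 0 + 2) ^ 3 - 3 * (X 0 + 2) * (X 0 - 1))) * Polynomial.X +
    Polynomial.C ((X 0 - 1) ^ 3)

/-- `rootChainPolyX₁` is monic. [folklore] -/
theorem monic_rootChainPolyX₁ : rootChainPolyX₁.Monic := by unfold rootChainPolyX₁; monicity!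
/-- `rootChainPolyY₁` is monic. [folklore] -/
theorem monic_rootChainPolyY₁ : rootChainPolyY₁.Monic := by unfold rootChainPolyY₁; monicity!
/-- `rootChainPolyX₂` is monic. [folklore] -/
theorem monic_rootChainPolyX₂ : rootChainPolyX₂.Monic := by unfold rootChainPolyX₂; monicity!

/-- `rootChainW` has dimension `≤ 1 < 2`: all coordinates are integral over `ℂ[x₁ + y₁]`.
[folklore] -/
theorem zariskiDim_rootChainW : zariskiDim ℂ rootChainW < 2 := by
  have hdim : ringKrullDim (MvPolynomial (Fin 1) ℂ) = (1 : ℕ) := by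
    rw [MvPolynomial.ringKrullDim_of_isNoetherianRing, ringKrullDim_eq_zero_of_field, zero_add,
      Nat.card_eq_fintype_card, Fintype.card_fin]
  refine lt_of_le_of_lt ?_ (lt_of_eq_of_lt hdim (by decide))
  refine zariskiDim_le_of_integral_gens rootChainW (fun _ : Fin 1 => X (Sum.inl 0) + X (Sum.inr 0)) ?_
  rintro (i | i) <;> fin_cases i
  · refine ⟨rootChainPolyX₁, monic_rootChainPolyX₁, fun w hw => ?_⟩
    obtain ⟨h1, h2, h3⟩ := hw
    simp only [rootChainPolyX₁, Polynomial.eval_map, Polynomial.eval₂_add, Polynomial.eval₂_mul,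
      Polynomial.eval₂_pow, Polynomial.eval₂_X, Polynomial.eval₂_C, Polynomial.eval₂_sub,
      Polynomial.eval₂_neg, Polynomial.eval₂_one, Polynomial.eval₂_ofNat,
      MvPolynomial.eval_X, map_add, map_neg, map_sub, map_one, map_ofNat,
      Fin.zero_eta, Fin.isValue]
    linear_combination rootChainW_cert_x₁ _ _ h3
  · refine ⟨rootChainPolyX₂, monic_rootChainPolyX₂, fun w hw => ?_⟩
    obtain ⟨h1, h2, h3⟩ := hw
    simp only [rootChainPolyX₂, Polynomial.eval_map, Polynomial.eval₂_add, Polynomial.eval₂_mul,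
      Polynomial.eval₂_pow, Polynomial.eval₂_X, Polynomial.eval₂_C, Polynomial.eval₂_sub,
      Polynomial.eval₂_neg, Polynomial.eval₂_one, Polynomial.eval₂_ofNat,
      MvPolynomial.eval_X, map_add, map_mul, map_pow, map_neg, map_sub, map_one, map_ofNat,
      Fin.mk_one, Fin.isValue]
    linear_combination rootChainW_cert_x₂ _ _ _ h1 h3
  · refine ⟨rootChainPolyY₁, monic_rootChainPolyY₁, fun w hw => ?_⟩
    obtain ⟨h1, h2, h3⟩ := hw
    simp only [rootChainPolyY₁, Polynomial.eval_map, Polynomial.eval₂_add, Polynomial.eval₂_mul,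
      Polynomial.eval₂_pow, Polynomial.eval₂_X, Polynomial.eval₂_C, Polynomial.eval₂_sub,
      Polynomial.eval₂_neg, Polynomial.eval₂_one, Polynomial.eval₂_ofNat,
      MvPolynomial.eval_X, map_add, map_neg, map_sub, map_one, map_ofNat,
      Fin.zero_eta, Fin.isValue]
    linear_combination rootChainW_cert_y₁ _ _ h3
  · refine ⟨Polynomial.X - Polynomial.C 1, Polynomial.monic_X_sub_C _, fun w hw => ?_⟩
    obtain ⟨h1, h2, h3⟩ := hw
    simp [h2]

/-- `π²` is irrational (Legendre; here from `transcendental_pi_holds`, Lindemann, PROVED in the tree).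
[folklore] -/
theorem pi_sq_ne_ratCast (q : ℚ) : Real.pi ^ 2 ≠ (q : ℝ) := by
  intro hq
  have halg : IsAlgebraic ℚ (Real.pi ^ 2) := by
    rw [hq]
    exact isAlgebraic_algebraMap q
  exact transcendental_pi_holds (halg.of_pow two_pos)

/-- `(t, t³)` is ℚ-linearly independent when `t ≠ 0` and `e^{t³} = 1` (then `t³ = 2πin`, `n ≠ 0`; a
relation would make `t² ∈ ℚ` and hence `π² ∈ ℚ`). [folklore] -/
theorem linearIndependent_pair_cube {t : ℂ} (ht : t ≠ 0) (h : Complex.exp (t ^ 3) = 1) :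
    LinearIndependent ℚ ![t, t ^ 3] := by
  obtain ⟨n, hn⟩ := Complex.exp_eq_one_iff.1 h
  have hn0 : (n : ℂ) ≠ 0 := by
    intro hn0
    rw [hn0, zero_mul] at hn
    exact ht (pow_eq_zero_iff (three_ne_zero) |>.1 hn)
  rw [LinearIndependent.pair_iff]
  intro s r hsr
  rw [Rat.smul_def, Rat.smul_def] at hsr
  by_cases hr : r = 0
  · subst hr
    have : (s : ℂ) * t = 0 := by simpa using hsr
    rcases mul_eq_zero.1 this with h' | h'
    · exact ⟨by exact_mod_cast h', rfl⟩
    · exact absurd h' ht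
  · exfalso
    have h2 : (s : ℂ) + r * t ^ 2 = 0 := by
      have h' : t * ((s : ℂ) + r * t ^ 2) = 0 := by linear_combination hsr
      rcases mul_eq_zero.1 h' with h'' | h''
      · exact absurd h'' ht
      · exact h''
    have h6a : t ^ 6 = (n : ℂ) ^ 2 * (2 * π * I) ^ 2 := by
      rw [show t ^ 6 = (t ^ 3) ^ 2 by ring, hn]; ring
    have h6b : (r : ℂ) ^ 3 * t ^ 6 = -(s : ℂ) ^ 3 := by
      have h'' : (r : ℂ) * t ^ 2 = -s := by linear_combination h2
      calc (r : ℂ) ^ 3 * t ^ 6 = ((r : ℂ) * t ^ 2) ^ 3 := by ring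
        _ = (-(s : ℂ)) ^ 3 := by rw [h'']
        _ = -(s : ℂ) ^ 3 := by ring
    have hI : Complex.I ^ 2 = -1 := Complex.I_sq
    have key : 4 * (r : ℂ) ^ 3 * (n : ℂ) ^ 2 * (Real.pi : ℂ) ^ 2 = (s : ℂ) ^ 3 := by
      linear_combination (-1 : ℂ) * h6b + (r : ℂ) ^ 3 * h6a +
        4 * (r : ℂ) ^ 3 * (n : ℂ) ^ 2 * (Real.pi : ℂ) ^ 2 * hI
    have hr' : (r : ℂ) ≠ 0 := by exact_mod_cast hr
    have hq : Real.pi ^ 2 = ((s ^ 3 / (4 * r ^ 3 * (n : ℚ) ^ 2) : ℚ) : ℝ) := by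
      apply Complex.ofReal_injective
      push_cast
      field_simp
      linear_combination key
    exact pi_sq_ne_ratCast _ hq

/-- **Sparsity at `n = 2` settles the root-chain atom**: SPARSITY(2) implies that
`eᵗ = (1 + t)/(1 − t)` has only finitely many solutions `t` with `t³ ∈ 2πiℤ ∖ {0}` — equivalently,
finitely many odd `M` with `‖π²M³/2 + 1/(π²M) + O(M⁻³)‖ = 0` exactly (§3a). OPEN: each hit violates
SC(2); no unconditional method known (depth-1 non-linear cusp / Puiseux-twist chain: outside
modulus splitting, Baker, Galois-norm, Liouville–Roth depth sieves, and finite-type heights).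
The simplest open instance of SPARSITY(2) known to us. [folklore] -/
theorem rootChain_finite_of_sparsity
    (h : ∀ W : Set (Fin 2 ⊕ Fin 2 → ℂ), IsDefinedOver (⊥ : Subfield ℂ) W → zariskiDim ℂ W < 2 →
      (indepExpPoints W).Finite) :
    Set.Finite {t : ℂ | t ≠ 0 ∧ Complex.exp (t ^ 3) = 1 ∧ (1 - t) * Complex.exp t = 1 + t} := by
  have hfin := h rootChainW isDefinedOver_rootChainW zariskiDim_rootChainW
  let m : ℂ → (Fin 2 → ℂ) := fun t => ![t, t ^ 3]
  have hm : Function.Injective m := fun a b hab => by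
    have := congrFun hab 0
    simpa [m] using this
  refine (hfin.preimage hm.injOn).subset ?_
  rintro t ⟨ht, hE, hC⟩
  refine ⟨linearIndependent_pair_cube ht hE, ?_, ?_, ?_⟩
  · simp [m]
  · simpa [m] using hE
  · simp only [m, Sum.elim_inl, Sum.elim_inr, Function.comp_apply, Matrix.cons_val_zero]
    linear_combination hC

/-! ## The double-Cayley cubic curve `{x₂ = x₁³, (1−x₁)(y₁+1) = 2, (1−x₂)(y₂+1) = 2}`
One component, four punctures (`x₁ = ∞, 1, ω, ω²`), so every coordinate is integral of degree 4
over `ℂ[x₁ + y₁ + y₂]`. Hits: common zeros of `F(t) = (1−t)eᵗ − (1+t)` and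
`F(t³) = (1−t³)e^{t³} − (1+t³)`. Off the strip `|Im t| ≤ 1` the zeros of `F` are purely imaginary,
`t = iθ_K`, `θ_K = πM − 2/θ_K + O(θ_K⁻³)` (`M = 2K+1`); then `t³ = −iθ_K³` is again on the axis and
`F(t³) = 0` iff `θ_K³ − 2arctan θ_K³ ∈ 2πℤ`, i.e. (expanding `θ_K³ = M³π³ − 6Mπ + 2/(Mπ) + O(M⁻³)`)
`‖π²M³/2 − 1/2 + 1/(π²M) + O(M⁻³)‖ = 0` — "two inexact chains with a non-linear end": a depth-1
Weyl-cubic target for `π²` (numerically `c·π² → 2.0002, 2.00002` at `K = 10, 100` for the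
coefficient `c/(2M)`). Not an exponential-polynomial pair in Ritt's sense (frequency `t³`), so even
Shapiro's conjecture does not cover it; SC(2) does (`trdeg ℚ(t, t³, eᵗ, e^{t³}) = trdeg ℚ(t) ≤ 1`).
-/

/-- The double-Cayley cubic curve `{x₂ = x₁³, (1−x₁)(y₁+1) = 2, (1−x₂)(y₂+1) = 2}` ⊆ ℂ² × ℂ².
[folklore] -/
def cubicW : Set (Fin 2 ⊕ Fin 2 → ℂ) :=
  {w | w (Sum.inl 1) = w (Sum.inl 0) ^ 3 ∧ (1 - w (Sum.inl 0)) * (w (Sum.inr 0) + 1) = 2 ∧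
    (1 - w (Sum.inl 1)) * (w (Sum.inr 1) + 1) = 2}

/-- `cubicW` is defined over the prime field. [folklore] -/
theorem isDefinedOver_cubicW : IsDefinedOver (⊥ : Subfield ℂ) cubicW := by
  refine ⟨Ideal.span {X (Sum.inl 1) - X (Sum.inl 0) ^ 3, (1 - X (Sum.inl 0)) * (X (Sum.inr 0) + 1) - 2,
    (1 - X (Sum.inl 1)) * (X (Sum.inr 1) + 1) - 2}, ?_⟩
  ext w
  simp only [cubicW, Set.mem_setOf_eq, zeroLocus_span, Set.mem_insert_iff,
    Set.mem_singleton_iff, forall_eq_or_imp, forall_eq, map_sub, map_mul, map_add, map_pow,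
    aeval_X, map_one, map_ofNat, sub_eq_zero]

-- Cofactors below were found by exact polynomial division (scripts cubic_certs.py / gen_cubic_lean.py,
-- attached as evidence on item stmt-Schanuel-0971); `linear_combination` re-verifies them in the kernel.
section cubicCerts
variable (x₁ x₂ y₁ y₂ u : ℂ) (hu : u = x₁ + y₁ + y₂) (h1 : x₂ = x₁ ^ 3)
  (h2 : (1 - x₁) * (y₁ + 1) = 2) (h3 : (1 - x₂) * (y₂ + 1) = 2)
include hu h1 h2 h3

/-- Monic quartic relation for `x₁` over `ℂ[u]`, `u = x₁ + y₁ + y₂`, on the double-Cayley cubic curve. [folklore] -/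
theorem cubicW_cert_x₁ :
    (-1 : ℂ) * x₁ ^ 3 * u + (1 : ℂ) * x₁ ^ 4 + (-2 : ℂ) * x₁ ^ 3 + (-2 : ℂ) * x₁ ^ 2 + (1 : ℂ) * u + (-3 : ℂ) * x₁ + (-2 : ℂ) = 0 := by
  linear_combination
    ((-1 : ℂ) * x₁ ^ 3 + (1 : ℂ)) * hu +
    ((1 : ℂ) * y₂ + (1 : ℂ)) * h1 +
    ((1 : ℂ) * x₁ ^ 2 + (1 : ℂ) * x₁ + (1 : ℂ)) * h2 +
    ((1 : ℂ)) * h3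

/-- Monic quartic relation for `x₂` over `ℂ[u]` on the double-Cayley cubic curve (`M(Y) = E³ + YF³ + Y²G³ − 3YEFG`, the cubic resultant of the `x₁`-quartic with `Y − X³`). [folklore] -/
theorem cubicW_cert_x₂ :
    (-1 : ℂ) * x₂ ^ 3 * u ^ 3 + (3 : ℂ) * x₂ ^ 2 * u ^ 3 + (-6 : ℂ) * x₂ ^ 3 * u ^ 2 + (-3 : ℂ) * x₂ * u ^ 3 + (6 : ℂ) * x₂ ^ 2 * u ^ 2 + (-18 : ℂ) * x₂ ^ 3 * u + (1 : ℂ) * x₂ ^ 4 + (1 : ℂ) * u ^ 3 + (6 : ℂ) * x₂ * u ^ 2 + (12 : ℂ) * x₂ ^ 2 * u + (-29 : ℂ) * x₂ ^ 3 + (-6 : ℂ) * u ^ 2 + (-6 : ℂ) * x₂ * u + (19 : ℂ) * x₂ ^ 2 + (12 : ℂ) * u + (-15 : ℂ) * x₂ + (-8 : ℂ) = 0 := by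
  linear_combination
    ((-1 : ℂ) * x₁ ^ 9 * u ^ 2 + (-1 : ℂ) * x₁ ^ 10 * u + (-1 : ℂ) * x₁ ^ 11 + (-4 : ℂ) * x₁ ^ 9 * u + (-2 : ℂ) * x₁ ^ 10 + (2 : ℂ) * x₁ ^ 8 * u + (-6 : ℂ) * x₁ ^ 9 + (3 : ℂ) * x₁ ^ 6 * u ^ 2 + (5 : ℂ) * x₁ ^ 7 * u + (11 : ℂ) * x₁ ^ 8 + (4 : ℂ) * x₁ ^ 6 * u + (2 : ℂ) * x₁ ^ 7 + (-4 : ℂ) * x₁ ^ 5 * u + (4 : ℂ) * x₁ ^ 6 + (-3 : ℂ) * x₁ ^ 3 * u ^ 2 + (-7 : ℂ) * x₁ ^ 4 * u + (-15 : ℂ) * x₁ ^ 5 + (4 : ℂ) * x₁ ^ 3 * u + (6 : ℂ) * x₁ ^ 4 + (2 : ℂ) * x₁ ^ 2 * u + (-2 : ℂ) * x₁ ^ 3 + (1 : ℂ) * u ^ 2 + (3 : ℂ) * x₁ * u + (5 : ℂ) * x₁ ^ 2 + (-4 : ℂ) * u + (-6 : ℂ) * x₁ + (4 : ℂ)) *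 hu +
    ((-1 : ℂ) * x₁ ^ 6 * u ^ 3 + (1 : ℂ) * x₁ ^ 6 * y₂ * u ^ 2 + (1 : ℂ) * x₁ ^ 7 * y₂ * u + (1 : ℂ) * x₁ ^ 8 * y₂ + (1 : ℂ) * x₁ ^ 9 + (-5 : ℂ) * x₁ ^ 6 * u ^ 2 + (4 : ℂ) * x₁ ^ 6 * y₂ * u + (1 : ℂ) * x₁ ^ 7 * u + (2 : ℂ) * x₁ ^ 7 * y₂ + (1 : ℂ) * x₁ ^ 8 + (-1 : ℂ) * x₁ ^ 3 * x₂ * u ^ 3 + (-2 : ℂ) * x₁ ^ 5 * y₂ * u + (-14 : ℂ) * x₁ ^ 6 * u + (6 : ℂ) * x₁ ^ 6 * y₂ + (1 : ℂ) * x₁ ^ 6 * x₂ + (2 : ℂ) * x₁ ^ 7 + (3 : ℂ) * x₁ ^ 3 * u ^ 3 + (-2 : ℂ) * x₁ ^ 3 * y₂ * u ^ 2 + (-6 : ℂ) * x₁ ^ 3 * x₂ * u ^ 2 + (-4 : ℂ) * x₁ ^ 4 * y₂ * u + (-2 : ℂ) * x₁ ^ 5 * u + (-10 : ℂ) * x₁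 ^ 5 * y₂ + (-23 : ℂ) * x₁ ^ 6 + (-1 : ℂ) * x₂ ^ 2 * u ^ 3 + (4 : ℂ) * x₁ ^ 3 * u ^ 2 + (-18 : ℂ) * x₁ ^ 3 * x₂ * u + (1 : ℂ) * x₁ ^ 3 * x₂ ^ 2 + (-4 : ℂ) * x₁ ^ 4 * u + (-10 : ℂ) * x₁ ^ 5 + (3 : ℂ) * x₂ * u ^ 3 + (-6 : ℂ) * x₂ ^ 2 * u ^ 2 + (2 : ℂ) * x₁ ^ 2 * y₂ * u + (12 : ℂ) * x₁ ^ 3 * u + (2 : ℂ) * x₁ ^ 3 * y₂ + (-29 : ℂ) * x₁ ^ 3 * x₂ + (-3 : ℂ) * u ^ 3 + (1 : ℂ) * y₂ * u ^ 2 + (6 : ℂ) * x₂ * u ^ 2 + (-18 : ℂ) * x₂ ^ 2 * u + (1 : ℂ) * x₂ ^ 3 + (3 : ℂ) * x₁ * y₂ * u + (2 : ℂ) * x₁ ^ 2 * u + (5 : ℂ) * x₁ ^ 2 * y₂ + (21 : ℂ) * x₁ ^ 3 + (7 : ℂ) * u ^ 2 + (-4 : ℂ) * y₂ * u + (12 :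 ℂ) * x₂ * u + (-29 : ℂ) * x₂ ^ 2 + (3 : ℂ) * x₁ * u + (-6 : ℂ) * x₁ * y₂ + (5 : ℂ) * x₁ ^ 2 + (-10 : ℂ) * u + (4 : ℂ) * y₂ + (19 : ℂ) * x₂ + (-6 : ℂ) * x₁ + (-11 : ℂ)) * h1 +
    ((1 : ℂ) * x₁ ^ 8 * u ^ 2 + (1 : ℂ) * x₁ ^ 9 * u + (1 : ℂ) * x₁ ^ 10 + (1 : ℂ) * x₁ ^ 7 * u ^ 2 + (5 : ℂ) * x₁ ^ 8 * u + (3 : ℂ) * x₁ ^ 9 + (1 : ℂ) * x₁ ^ 6 * u ^ 2 + (3 : ℂ) * x₁ ^ 7 * u + (9 : ℂ) * x₁ ^ 8 + (-2 : ℂ) * x₁ ^ 5 * u ^ 2 + (-2 : ℂ) * x₁ ^ 6 * u + (-2 : ℂ) * x₁ ^ 7 + (-2 : ℂ) * x₁ ^ 4 * u ^ 2 + (-6 : ℂ) * x₁ ^ 5 * u + (-4 : ℂ) * x₁ ^ 6 + (-2 : ℂ) * x₁ ^ 3 * u ^ 2 + (-2 : ℂ) * x₁ ^ 4 * u + (-8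 : ℂ) * x₁ ^ 5 + (1 : ℂ) * x₁ ^ 2 * u ^ 2 + (5 : ℂ) * x₁ ^ 3 * u + (7 : ℂ) * x₁ ^ 4 + (1 : ℂ) * x₁ * u ^ 2 + (1 : ℂ) * x₁ ^ 2 * u + (1 : ℂ) * x₁ ^ 3 + (1 : ℂ) * u ^ 2 + (-1 : ℂ) * x₁ * u + (3 : ℂ) * x₁ ^ 2 + (-4 : ℂ) * u + (-2 : ℂ) * x₁ + (4 : ℂ)) * h2 +
    ((1 : ℂ) * x₁ ^ 6 * u ^ 2 + (1 : ℂ) * x₁ ^ 7 * u + (1 : ℂ) * x₁ ^ 8 + (4 : ℂ) * x₁ ^ 6 * u + (2 : ℂ) * x₁ ^ 7 + (-2 : ℂ) * x₁ ^ 5 * u + (6 : ℂ) * x₁ ^ 6 + (-2 : ℂ) * x₁ ^ 3 * u ^ 2 + (-4 : ℂ) * x₁ ^ 4 * u + (-10 : ℂ) * x₁ ^ 5 + (2 : ℂ) * x₁ ^ 2 * u + (2 : ℂ) * x₁ ^ 3 + (1 : ℂ) * u ^ 2 + (3 : ℂ) * x₁ * u + (5 : ℂ) * x₁ ^ 2 +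 (-4 : ℂ) * u + (-6 : ℂ) * x₁ + (4 : ℂ)) * h3

/-- Monic quartic relation for `y₁` over `ℂ[u]` on the double-Cayley cubic curve (`T⁴·m(1 − 2/T)/m(1)` at `T = y₁ + 1`, `m(1) = −8`). [folklore] -/
theorem cubicW_cert_y₁ :
    ((-3 : ℂ) / 4) * y₁ ^ 3 * u + (1 : ℂ) * y₁ ^ 4 + ((-3 : ℂ) / 4) * y₁ ^ 2 * u + ((7 : ℂ) / 4) * y₁ ^ 3 + ((-1 : ℂ) / 4) * y₁ * u + ((1 : ℂ) / 4) * y₁ ^ 2 + ((-1 : ℂ) / 4) * u + ((5 : ℂ) / 4) * y₁ + ((-1 : ℂ) / 4) = 0 := by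
  linear_combination
    (((1 : ℂ) / 8) * x₁ ^ 3 * y₁ ^ 4 + ((1 : ℂ) / 2) * x₁ ^ 3 * y₁ ^ 3 + ((3 : ℂ) / 4) * x₁ ^ 3 * y₁ ^ 2 + ((-1 : ℂ) / 8) * y₁ ^ 4 + ((1 : ℂ) / 2) * x₁ ^ 3 * y₁ + ((-1 : ℂ) / 2) * y₁ ^ 3 + ((1 : ℂ) / 8) * x₁ ^ 3 + ((-3 : ℂ) / 4) * y₁ ^ 2 + ((-1 : ℂ) / 2) * y₁ + ((-1 : ℂ) / 8)) * hu +
    (((-1 : ℂ) / 8) * y₁ ^ 4 * y₂ + ((-1 : ℂ) / 2) * y₁ ^ 3 * y₂ + ((-1 : ℂ) / 8) * y₁ ^ 4 + ((-3 : ℂ) / 4) * y₁ ^ 2 * y₂ + ((-1 : ℂ) / 2) * y₁ ^ 3 + ((-1 : ℂ) / 2) * y₁ * y₂ + ((-3 : ℂ) / 4) * y₁ ^ 2 + ((-1 : ℂ) / 8) * y₂ + ((-1 : ℂ) / 2) * y₁ + ((-1 : ℂ) / 8)) * h1 +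
    (((1 : ℂ) / 8) * x₁ ^ 2 * y₁ ^ 3 * u + ((-1 : ℂ) / 8) * x₁ ^ 2 * y₁ ^ 4 + ((-1 : ℂ) / 8) * x₁ ^ 3 * y₁ ^ 3 + ((1 : ℂ) / 8) * x₁ * y₁ ^ 3 * u + ((-1 : ℂ) / 8) * x₁ * y₁ ^ 4 + ((3 : ℂ) / 8) * x₁ ^ 2 * y₁ ^ 2 * u + ((-3 : ℂ) / 8) * x₁ ^ 2 * y₁ ^ 3 + ((-3 : ℂ) / 8) * x₁ ^ 3 * y₁ ^ 2 + ((1 : ℂ) / 8) * y₁ ^ 3 * u + ((-1 : ℂ) / 8) * y₁ ^ 4 + ((1 : ℂ) / 8) * x₁ * y₁ ^ 2 * u + ((-1 : ℂ) / 8) * x₁ * y₁ ^ 3 + ((3 : ℂ) / 8) * x₁ ^ 2 * y₁ * u + ((-1 : ℂ) / 8) * x₁ ^ 2 * y₁ ^ 2 + ((-3 : ℂ) / 8) * x₁ ^ 3 * y₁ + ((-1 : ℂ) / 8) * y₁ ^ 2 * u + ((1 : ℂ) / 4) * y₁ ^ 3 + ((-1 : ℂ) / 8) * x₁ * y₁ *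 u + ((3 : ℂ) / 8) * x₁ * y₁ ^ 2 + ((1 : ℂ) / 8) * x₁ ^ 2 * u + ((3 : ℂ) / 8) * x₁ ^ 2 * y₁ + ((-1 : ℂ) / 8) * x₁ ^ 3 + ((-1 : ℂ) / 8) * y₁ * u + ((3 : ℂ) / 4) * y₁ ^ 2 + ((-1 : ℂ) / 8) * x₁ * u + ((1 : ℂ) / 8) * x₁ * y₁ + ((1 : ℂ) / 4) * x₁ ^ 2 + ((1 : ℂ) / 8) * u + ((-1 : ℂ) / 4) * y₁ + ((-1 : ℂ) / 4) * x₁ + ((3 : ℂ) / 8)) * h2 +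
    (((-1 : ℂ) / 8) * y₁ ^ 4 + ((-1 : ℂ) / 2) * y₁ ^ 3 + ((-3 : ℂ) / 4) * y₁ ^ 2 + ((-1 : ℂ) / 2) * y₁ + ((-1 : ℂ) / 8)) * h3

/-- Monic quartic relation for `y₂` over `ℂ[u]` on the double-Cayley cubic curve (`T⁴·M(1 − 2/T)/M(1)` at `T = y₂ + 1`, `M(1) = −32`). [folklore] -/
theorem cubicW_cert_y₂ :
    ((-1 : ℂ) / 4) * y₂ * u ^ 3 + ((3 : ℂ) / 2) * y₂ ^ 2 * u ^ 2 + ((-9 : ℂ) / 4) * y₂ ^ 3 * u + (1 : ℂ) * y₂ ^ 4 + ((-1 : ℂ) / 4) * u ^ 3 + ((3 : ℂ) / 2) * y₂ * u ^ 2 + ((-3 : ℂ) / 2) * y₂ ^ 2 * u + ((1 : ℂ) / 4) * y₂ ^ 3 + ((-3 : ℂ) / 4) * y₂ * u + ((5 : ℂ) / 2) * y₂ ^ 2 + ((-3 : ℂ) / 2) * u + (2 : ℂ) * y₂ + ((-7 : ℂ) / 4) = 0 := by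
  linear_combination
    (((1 : ℂ) / 32) * x₁ ^ 9 * y₂ ^ 4 * u ^ 2 + ((1 : ℂ) / 32) * x₁ ^ 10 * y₂ ^ 4 * u + ((1 : ℂ) / 32) * x₁ ^ 11 * y₂ ^ 4 + ((1 : ℂ) / 8) * x₁ ^ 9 * y₂ ^ 3 * u ^ 2 + ((1 : ℂ) / 8) * x₁ ^ 9 * y₂ ^ 4 * u + ((1 : ℂ) / 8) * x₁ ^ 10 * y₂ ^ 3 * u + ((1 : ℂ) / 16) * x₁ ^ 10 * y₂ ^ 4 + ((1 : ℂ) / 8) * x₁ ^ 11 * y₂ ^ 3 + ((-1 : ℂ) / 16) * x₁ ^ 8 * y₂ ^ 4 * u + ((3 : ℂ) / 16) * x₁ ^ 9 * y₂ ^ 2 * u ^ 2 + ((1 : ℂ) / 2) * x₁ ^ 9 * y₂ ^ 3 * u + ((3 : ℂ) / 16) * x₁ ^ 9 * y₂ ^ 4 + ((3 : ℂ) / 16) * x₁ ^ 10 * y₂ ^ 2 * u + ((1 : ℂ) / 4) * x₁ ^ 10 * y₂ ^ 3 + ((3 : ℂ) / 16) * x₁ ^ 11 * y₂ ^ 2 +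 ((-3 : ℂ) / 32) * x₁ ^ 6 * y₂ ^ 4 * u ^ 2 + ((-5 : ℂ) / 32) * x₁ ^ 7 * y₂ ^ 4 * u + ((-1 : ℂ) / 4) * x₁ ^ 8 * y₂ ^ 3 * u + ((-11 : ℂ) / 32) * x₁ ^ 8 * y₂ ^ 4 + ((1 : ℂ) / 8) * x₁ ^ 9 * y₂ * u ^ 2 + ((3 : ℂ) / 4) * x₁ ^ 9 * y₂ ^ 2 * u + ((3 : ℂ) / 4) * x₁ ^ 9 * y₂ ^ 3 + ((1 : ℂ) / 8) * x₁ ^ 10 * y₂ * u + ((3 : ℂ) / 8) * x₁ ^ 10 * y₂ ^ 2 + ((1 : ℂ) / 8) * x₁ ^ 11 * y₂ + ((-3 : ℂ) / 8) * x₁ ^ 6 * y₂ ^ 3 * u ^ 2 + ((-1 : ℂ) / 8) * x₁ ^ 6 * y₂ ^ 4 * u + ((-5 : ℂ) / 8) * x₁ ^ 7 * y₂ ^ 3 * u + ((-1 : ℂ) / 16) * x₁ ^ 7 * y₂ ^ 4 + ((-3 : ℂ) / 8) * x₁ ^ 8 * y₂ ^ 2 * u + ((-11 : ℂ) / 8)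 * x₁ ^ 8 * y₂ ^ 3 + ((1 : ℂ) / 32) * x₁ ^ 9 * u ^ 2 + ((1 : ℂ) / 2) * x₁ ^ 9 * y₂ * u + ((9 : ℂ) / 8) * x₁ ^ 9 * y₂ ^ 2 + ((1 : ℂ) / 32) * x₁ ^ 10 * u + ((1 : ℂ) / 4) * x₁ ^ 10 * y₂ + ((1 : ℂ) / 32) * x₁ ^ 11 + ((1 : ℂ) / 8) * x₁ ^ 5 * y₂ ^ 4 * u + ((-9 : ℂ) / 16) * x₁ ^ 6 * y₂ ^ 2 * u ^ 2 + ((-1 : ℂ) / 2) * x₁ ^ 6 * y₂ ^ 3 * u + ((-1 : ℂ) / 8) * x₁ ^ 6 * y₂ ^ 4 + ((-15 : ℂ) / 16) * x₁ ^ 7 * y₂ ^ 2 * u + ((-1 : ℂ) / 4) * x₁ ^ 7 * y₂ ^ 3 + ((-1 : ℂ) / 4) * x₁ ^ 8 * y₂ * u + ((-33 : ℂ) / 16) * x₁ ^ 8 * y₂ ^ 2 + ((1 : ℂ) / 8) * x₁ ^ 9 * u + ((3 : ℂ) / 4) * x₁ ^ 9 * y₂ + ((1 : ℂ) / 16) *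 x₁ ^ 10 + ((3 : ℂ) / 32) * x₁ ^ 3 * y₂ ^ 4 * u ^ 2 + ((7 : ℂ) / 32) * x₁ ^ 4 * y₂ ^ 4 * u + ((1 : ℂ) / 2) * x₁ ^ 5 * y₂ ^ 3 * u + ((15 : ℂ) / 32) * x₁ ^ 5 * y₂ ^ 4 + ((-3 : ℂ) / 8) * x₁ ^ 6 * y₂ * u ^ 2 + ((-3 : ℂ) / 4) * x₁ ^ 6 * y₂ ^ 2 * u + ((-1 : ℂ) / 2) * x₁ ^ 6 * y₂ ^ 3 + ((-5 : ℂ) / 8) * x₁ ^ 7 * y₂ * u + ((-3 : ℂ) / 8) * x₁ ^ 7 * y₂ ^ 2 + ((-1 : ℂ) / 16) * x₁ ^ 8 * u + ((-11 : ℂ) / 8) * x₁ ^ 8 * y₂ + ((3 : ℂ) / 16) * x₁ ^ 9 + ((3 : ℂ) / 8) * x₁ ^ 3 * y₂ ^ 3 * u ^ 2 + ((-1 : ℂ) / 8) * x₁ ^ 3 * y₂ ^ 4 * u + ((7 : ℂ) / 8) * x₁ ^ 4 * y₂ ^ 3 * u + ((-3 : ℂ) / 16) * x₁ ^ 4 *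 y₂ ^ 4 + ((3 : ℂ) / 4) * x₁ ^ 5 * y₂ ^ 2 * u + ((15 : ℂ) / 8) * x₁ ^ 5 * y₂ ^ 3 + ((-3 : ℂ) / 32) * x₁ ^ 6 * u ^ 2 + ((-1 : ℂ) / 2) * x₁ ^ 6 * y₂ * u + ((-3 : ℂ) / 4) * x₁ ^ 6 * y₂ ^ 2 + ((-5 : ℂ) / 32) * x₁ ^ 7 * u + ((-1 : ℂ) / 4) * x₁ ^ 7 * y₂ + ((-11 : ℂ) / 32) * x₁ ^ 8 + ((-1 : ℂ) / 16) * x₁ ^ 2 * y₂ ^ 4 * u + ((9 : ℂ) / 16) * x₁ ^ 3 * y₂ ^ 2 * u ^ 2 + ((-1 : ℂ) / 2) * x₁ ^ 3 * y₂ ^ 3 * u + ((1 : ℂ) / 16) * x₁ ^ 3 * y₂ ^ 4 + ((21 : ℂ) / 16) * x₁ ^ 4 * y₂ ^ 2 * u + ((-3 : ℂ) / 4) * x₁ ^ 4 * y₂ ^ 3 + ((1 : ℂ) / 2) * x₁ ^ 5 * y₂ * u + ((45 : ℂ) / 16) * x₁ ^ 5 * y₂ ^ 2 + ((-1 : ℂ)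 / 8) * x₁ ^ 6 * u + ((-1 : ℂ) / 2) * x₁ ^ 6 * y₂ + ((-1 : ℂ) / 16) * x₁ ^ 7 + ((-1 : ℂ) / 32) * y₂ ^ 4 * u ^ 2 + ((-3 : ℂ) / 32) * x₁ * y₂ ^ 4 * u + ((-1 : ℂ) / 4) * x₁ ^ 2 * y₂ ^ 3 * u + ((-5 : ℂ) / 32) * x₁ ^ 2 * y₂ ^ 4 + ((3 : ℂ) / 8) * x₁ ^ 3 * y₂ * u ^ 2 + ((-3 : ℂ) / 4) * x₁ ^ 3 * y₂ ^ 2 * u + ((1 : ℂ) / 4) * x₁ ^ 3 * y₂ ^ 3 + ((7 : ℂ) / 8) * x₁ ^ 4 * y₂ * u + ((-9 : ℂ) / 8) * x₁ ^ 4 * y₂ ^ 2 + ((1 : ℂ) / 8) * x₁ ^ 5 * u + ((15 : ℂ) / 8) * x₁ ^ 5 * y₂ + ((-1 : ℂ) / 8) * x₁ ^ 6 + ((-1 : ℂ) / 8) * y₂ ^ 3 * u ^ 2 + ((1 : ℂ) / 8) * y₂ ^ 4 * u + ((-3 : ℂ) / 8) * x₁ * y₂ ^ 3 * u + ((3 :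 ℂ) / 16) * x₁ * y₂ ^ 4 + ((-3 : ℂ) / 8) * x₁ ^ 2 * y₂ ^ 2 * u + ((-5 : ℂ) / 8) * x₁ ^ 2 * y₂ ^ 3 + ((3 : ℂ) / 32) * x₁ ^ 3 * u ^ 2 + ((-1 : ℂ) / 2) * x₁ ^ 3 * y₂ * u + ((3 : ℂ) / 8) * x₁ ^ 3 * y₂ ^ 2 + ((7 : ℂ) / 32) * x₁ ^ 4 * u + ((-3 : ℂ) / 4) * x₁ ^ 4 * y₂ + ((15 : ℂ) / 32) * x₁ ^ 5 + ((-3 : ℂ) / 16) * y₂ ^ 2 * u ^ 2 + ((1 : ℂ) / 2) * y₂ ^ 3 * u + ((-1 : ℂ) / 8) * y₂ ^ 4 + ((-9 : ℂ) / 16) * x₁ * y₂ ^ 2 * u + ((3 : ℂ) / 4) * x₁ * y₂ ^ 3 + ((-1 : ℂ) / 4) * x₁ ^ 2 * y₂ * u + ((-15 : ℂ) / 16) * x₁ ^ 2 * y₂ ^ 2 + ((-1 : ℂ) / 8) * x₁ ^ 3 * u + ((1 : ℂ) / 4) * x₁ ^ 3 * y₂ + ((-3 : ℂ) / 16) * x₁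 ^ 4 + ((-1 : ℂ) / 8) * y₂ * u ^ 2 + ((3 : ℂ) / 4) * y₂ ^ 2 * u + ((-1 : ℂ) / 2) * y₂ ^ 3 + ((-3 : ℂ) / 8) * x₁ * y₂ * u + ((9 : ℂ) / 8) * x₁ * y₂ ^ 2 + ((-1 : ℂ) / 16) * x₁ ^ 2 * u + ((-5 : ℂ) / 8) * x₁ ^ 2 * y₂ + ((1 : ℂ) / 16) * x₁ ^ 3 + ((-1 : ℂ) / 32) * u ^ 2 + ((1 : ℂ) / 2) * y₂ * u + ((-3 : ℂ) / 4) * y₂ ^ 2 + ((-3 : ℂ) / 32) * x₁ * u + ((3 : ℂ) / 4) * x₁ * y₂ + ((-5 : ℂ) / 32) * x₁ ^ 2 + ((1 : ℂ) / 8) * u + ((-1 : ℂ) / 2) * y₂ + ((3 : ℂ) / 16) * x₁ + ((-1 : ℂ) / 8)) * hu +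
    (((1 : ℂ) / 32) * x₁ ^ 6 * y₂ ^ 4 * u ^ 3 + ((-1 : ℂ) / 32) * x₁ ^ 6 * y₂ ^ 5 * u ^ 2 + ((-1 : ℂ) / 32) * x₁ ^ 7 * y₂ ^ 5 * u + ((-1 : ℂ) / 32) * x₁ ^ 8 * y₂ ^ 5 + ((-1 : ℂ) / 32) * x₁ ^ 9 * y₂ ^ 4 + ((1 : ℂ) / 8) * x₁ ^ 6 * y₂ ^ 3 * u ^ 3 + ((1 : ℂ) / 32) * x₁ ^ 6 * y₂ ^ 4 * u ^ 2 + ((-1 : ℂ) / 8) * x₁ ^ 6 * y₂ ^ 5 * u + ((-5 : ℂ) / 32) * x₁ ^ 7 * y₂ ^ 4 * u + ((-1 : ℂ) / 16) * x₁ ^ 7 * y₂ ^ 5 + ((-5 : ℂ) / 32) * x₁ ^ 8 * y₂ ^ 4 + ((-1 : ℂ) / 8) * x₁ ^ 9 * y₂ ^ 3 + ((1 : ℂ) / 32) * x₁ ^ 3 * x₂ * y₂ ^ 4 * u ^ 3 + ((1 : ℂ) / 16) * x₁ ^ 5 * y₂ ^ 5 * u + ((3 : ℂ) / 16) * x₁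 ^ 6 * y₂ ^ 2 * u ^ 3 + ((7 : ℂ) / 16) * x₁ ^ 6 * y₂ ^ 3 * u ^ 2 + ((-1 : ℂ) / 16) * x₁ ^ 6 * y₂ ^ 4 * u + ((-3 : ℂ) / 16) * x₁ ^ 6 * y₂ ^ 5 + ((-1 : ℂ) / 32) * x₁ ^ 6 * x₂ * y₂ ^ 4 + ((-5 : ℂ) / 16) * x₁ ^ 7 * y₂ ^ 3 * u + ((-5 : ℂ) / 16) * x₁ ^ 7 * y₂ ^ 4 + ((-5 : ℂ) / 16) * x₁ ^ 8 * y₂ ^ 3 + ((-3 : ℂ) / 16) * x₁ ^ 9 * y₂ ^ 2 + ((-3 : ℂ) / 32) * x₁ ^ 3 * y₂ ^ 4 * u ^ 3 + ((1 : ℂ) / 16) * x₁ ^ 3 * y₂ ^ 5 * u ^ 2 + ((1 : ℂ) / 8) * x₁ ^ 3 * x₂ * y₂ ^ 3 * u ^ 3 + ((3 : ℂ) / 16) * x₁ ^ 3 * x₂ * y₂ ^ 4 * u ^ 2 + ((1 : ℂ) / 8) * x₁ ^ 4 * y₂ ^ 5 * u + ((5 : ℂ) / 16) * x₁ ^ 5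 * y₂ ^ 4 * u + ((5 : ℂ) / 16) * x₁ ^ 5 * y₂ ^ 5 + ((1 : ℂ) / 8) * x₁ ^ 6 * y₂ * u ^ 3 + ((13 : ℂ) / 16) * x₁ ^ 6 * y₂ ^ 2 * u ^ 2 + (1 : ℂ) * x₁ ^ 6 * y₂ ^ 3 * u + ((-1 : ℂ) / 32) * x₁ ^ 6 * y₂ ^ 4 + ((-1 : ℂ) / 8) * x₁ ^ 6 * x₂ * y₂ ^ 3 + ((-5 : ℂ) / 16) * x₁ ^ 7 * y₂ ^ 2 * u + ((-5 : ℂ) / 8) * x₁ ^ 7 * y₂ ^ 3 + ((-5 : ℂ) / 16) * x₁ ^ 8 * y₂ ^ 2 + ((-1 : ℂ) / 8) * x₁ ^ 9 * y₂ + ((1 : ℂ) / 32) * x₂ ^ 2 * y₂ ^ 4 * u ^ 3 + ((-3 : ℂ) / 8) * x₁ ^ 3 * y₂ ^ 3 * u ^ 3 + ((1 : ℂ) / 8) * x₁ ^ 3 * y₂ ^ 4 * u ^ 2 + ((3 : ℂ) / 16) * x₁ ^ 3 * x₂ * y₂ ^ 2 * u ^ 3 + ((3 : ℂ) / 4) *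 x₁ ^ 3 * x₂ * y₂ ^ 3 * u ^ 2 + ((9 : ℂ) / 16) * x₁ ^ 3 * x₂ * y₂ ^ 4 * u + ((-1 : ℂ) / 32) * x₁ ^ 3 * x₂ ^ 2 * y₂ ^ 4 + ((5 : ℂ) / 8) * x₁ ^ 4 * y₂ ^ 4 * u + ((5 : ℂ) / 8) * x₁ ^ 5 * y₂ ^ 3 * u + ((25 : ℂ) / 16) * x₁ ^ 5 * y₂ ^ 4 + ((1 : ℂ) / 32) * x₁ ^ 6 * u ^ 3 + ((19 : ℂ) / 32) * x₁ ^ 6 * y₂ * u ^ 2 + ((17 : ℂ) / 8) * x₁ ^ 6 * y₂ ^ 2 * u + ((7 : ℂ) / 4) * x₁ ^ 6 * y₂ ^ 3 + ((-3 : ℂ) / 16) * x₁ ^ 6 * x₂ * y₂ ^ 2 + ((-5 : ℂ) / 32) * x₁ ^ 7 * y₂ * u + ((-5 : ℂ) / 8) * x₁ ^ 7 * y₂ ^ 2 + ((-5 : ℂ) / 32) * x₁ ^ 8 * y₂ + ((-1 : ℂ) / 32) * x₁ ^ 9 + ((-3 : ℂ) / 32) * x₂ * y₂ ^ 4 * u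 ^ 3 + ((1 : ℂ) / 8) * x₂ ^ 2 * y₂ ^ 3 * u ^ 3 + ((3 : ℂ) / 16) * x₂ ^ 2 * y₂ ^ 4 * u ^ 2 + ((-1 : ℂ) / 16) * x₁ ^ 2 * y₂ ^ 5 * u + ((-9 : ℂ) / 16) * x₁ ^ 3 * y₂ ^ 2 * u ^ 3 + ((-1 : ℂ) / 8) * x₁ ^ 3 * y₂ ^ 3 * u ^ 2 + ((-3 : ℂ) / 8) * x₁ ^ 3 * y₂ ^ 4 * u + ((-1 : ℂ) / 16) * x₁ ^ 3 * y₂ ^ 5 + ((1 : ℂ) / 8) * x₁ ^ 3 * x₂ * y₂ * u ^ 3 + ((9 : ℂ) / 8) * x₁ ^ 3 * x₂ * y₂ ^ 2 * u ^ 2 + ((9 : ℂ) / 4) * x₁ ^ 3 * x₂ * y₂ ^ 3 * u + ((29 : ℂ) / 32) * x₁ ^ 3 * x₂ * y₂ ^ 4 + ((-1 : ℂ) / 8) * x₁ ^ 3 * x₂ ^ 2 * y₂ ^ 3 + ((5 : ℂ) / 4) * x₁ ^ 4 * y₂ ^ 3 * u + ((5 : ℂ) / 8) * x₁ ^ 5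 * y₂ ^ 2 * u + ((25 : ℂ) / 8) * x₁ ^ 5 * y₂ ^ 3 + ((5 : ℂ) / 32) * x₁ ^ 6 * u ^ 2 + ((13 : ℂ) / 8) * x₁ ^ 6 * y₂ * u + ((57 : ℂ) / 16) * x₁ ^ 6 * y₂ ^ 2 + ((-1 : ℂ) / 8) * x₁ ^ 6 * x₂ * y₂ + ((-1 : ℂ) / 32) * x₁ ^ 7 * u + ((-5 : ℂ) / 16) * x₁ ^ 7 * y₂ + ((-1 : ℂ) / 32) * x₁ ^ 8 + ((3 : ℂ) / 32) * y₂ ^ 4 * u ^ 3 + ((-1 : ℂ) / 32) * y₂ ^ 5 * u ^ 2 + ((-3 : ℂ) / 8) * x₂ * y₂ ^ 3 * u ^ 3 + ((-3 : ℂ) / 16) * x₂ * y₂ ^ 4 * u ^ 2 + ((3 : ℂ) / 16) * x₂ ^ 2 * y₂ ^ 2 * u ^ 3 + ((3 : ℂ) / 4) * x₂ ^ 2 * y₂ ^ 3 * u ^ 2 + ((9 : ℂ) / 16) * x₂ ^ 2 * y₂ ^ 4 * u + ((-1 : ℂ) / 32) * x₂ ^ 3 * y₂ ^ 4 + ((-3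 : ℂ) / 32) * x₁ * y₂ ^ 5 * u + ((-5 : ℂ) / 16) * x₁ ^ 2 * y₂ ^ 4 * u + ((-5 : ℂ) / 32) * x₁ ^ 2 * y₂ ^ 5 + ((-3 : ℂ) / 8) * x₁ ^ 3 * y₂ * u ^ 3 + ((-1 : ℂ) / 2) * x₁ ^ 3 * y₂ ^ 2 * u ^ 2 + ((-3 : ℂ) / 2) * x₁ ^ 3 * y₂ ^ 3 * u + ((-29 : ℂ) / 32) * x₁ ^ 3 * y₂ ^ 4 + ((1 : ℂ) / 32) * x₁ ^ 3 * x₂ * u ^ 3 + ((3 : ℂ) / 4) * x₁ ^ 3 * x₂ * y₂ * u ^ 2 + ((27 : ℂ) / 8) * x₁ ^ 3 * x₂ * y₂ ^ 2 * u + ((29 : ℂ) / 8) * x₁ ^ 3 * x₂ * y₂ ^ 3 + ((-3 : ℂ) / 16) * x₁ ^ 3 * x₂ ^ 2 * y₂ ^ 2 + ((5 : ℂ) / 4) * x₁ ^ 4 * y₂ ^ 2 * u + ((5 : ℂ) / 16) * x₁ ^ 5 * y₂ * u + ((25 : ℂ) / 8) * x₁ ^ 5 * y₂ ^ 2 + ((7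 : ℂ) / 16) * x₁ ^ 6 * u + ((43 : ℂ) / 16) * x₁ ^ 6 * y₂ + ((-1 : ℂ) / 32) * x₁ ^ 6 * x₂ + ((-1 : ℂ) / 16) * x₁ ^ 7 + ((3 : ℂ) / 8) * y₂ ^ 3 * u ^ 3 + ((-11 : ℂ) / 32) * y₂ ^ 4 * u ^ 2 + ((1 : ℂ) / 8) * y₂ ^ 5 * u + ((-9 : ℂ) / 16) * x₂ * y₂ ^ 2 * u ^ 3 + ((-3 : ℂ) / 4) * x₂ * y₂ ^ 3 * u ^ 2 + ((-3 : ℂ) / 8) * x₂ * y₂ ^ 4 * u + ((1 : ℂ) / 8) * x₂ ^ 2 * y₂ * u ^ 3 + ((9 : ℂ) / 8) * x₂ ^ 2 * y₂ ^ 2 * u ^ 2 + ((9 : ℂ) / 4) * x₂ ^ 2 * y₂ ^ 3 * u + ((29 : ℂ) / 32) * x₂ ^ 2 * y₂ ^ 4 + ((-1 : ℂ) / 8) * x₂ ^ 3 * y₂ ^ 3 + ((-15 : ℂ) / 32) * x₁ * y₂ ^ 4 * u + ((3 : ℂ) / 16) * x₁ * y₂ ^ 5 + ((-5 : ℂ)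 / 8) * x₁ ^ 2 * y₂ ^ 3 * u + ((-25 : ℂ) / 32) * x₁ ^ 2 * y₂ ^ 4 + ((-3 : ℂ) / 32) * x₁ ^ 3 * u ^ 3 + ((-7 : ℂ) / 16) * x₁ ^ 3 * y₂ * u ^ 2 + ((-9 : ℂ) / 4) * x₁ ^ 3 * y₂ ^ 2 * u + (-3 : ℂ) * x₁ ^ 3 * y₂ ^ 3 + ((3 : ℂ) / 16) * x₁ ^ 3 * x₂ * u ^ 2 + ((9 : ℂ) / 4) * x₁ ^ 3 * x₂ * y₂ * u + ((87 : ℂ) / 16) * x₁ ^ 3 * x₂ * y₂ ^ 2 + ((-1 : ℂ) / 8) * x₁ ^ 3 * x₂ ^ 2 * y₂ + ((5 : ℂ) / 8) * x₁ ^ 4 * y₂ * u + ((1 : ℂ) / 16) * x₁ ^ 5 * u + ((25 : ℂ) / 16) * x₁ ^ 5 * y₂ + ((23 : ℂ) / 32) * x₁ ^ 6 + ((9 : ℂ) / 16) * y₂ ^ 2 * u ^ 3 + ((-17 : ℂ) / 16) * y₂ ^ 3 * u ^ 2 + ((13 : ℂ) / 16) * y₂ ^ 4 * u + ((-1 : ℂ)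 / 8) * y₂ ^ 5 + ((-3 : ℂ) / 8) * x₂ * y₂ * u ^ 3 + ((-9 : ℂ) / 8) * x₂ * y₂ ^ 2 * u ^ 2 + ((-3 : ℂ) / 2) * x₂ * y₂ ^ 3 * u + ((-19 : ℂ) / 32) * x₂ * y₂ ^ 4 + ((1 : ℂ) / 32) * x₂ ^ 2 * u ^ 3 + ((3 : ℂ) / 4) * x₂ ^ 2 * y₂ * u ^ 2 + ((27 : ℂ) / 8) * x₂ ^ 2 * y₂ ^ 2 * u + ((29 : ℂ) / 8) * x₂ ^ 2 * y₂ ^ 3 + ((-3 : ℂ) / 16) * x₂ ^ 3 * y₂ ^ 2 + ((-15 : ℂ) / 16) * x₁ * y₂ ^ 3 * u + ((15 : ℂ) / 16) * x₁ * y₂ ^ 4 + ((-5 : ℂ) / 8) * x₁ ^ 2 * y₂ ^ 2 * u + ((-25 : ℂ) / 16) * x₁ ^ 2 * y₂ ^ 3 + ((-1 : ℂ) / 8) * x₁ ^ 3 * u ^ 2 + ((-3 : ℂ) / 2) * x₁ ^ 3 * y₂ * u + ((-67 : ℂ) / 16) * x₁ ^ 3 * y₂ ^ 2 + ((9 : ℂ)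 / 16) * x₁ ^ 3 * x₂ * u + ((29 : ℂ) / 8) * x₁ ^ 3 * x₂ * y₂ + ((-1 : ℂ) / 32) * x₁ ^ 3 * x₂ ^ 2 + ((1 : ℂ) / 8) * x₁ ^ 4 * u + ((5 : ℂ) / 16) * x₁ ^ 5 + ((3 : ℂ) / 8) * y₂ * u ^ 3 + ((-23 : ℂ) / 16) * y₂ ^ 2 * u ^ 2 + (2 : ℂ) * y₂ ^ 3 * u + ((-5 : ℂ) / 32) * y₂ ^ 4 + ((-3 : ℂ) / 32) * x₂ * u ^ 3 + ((-3 : ℂ) / 4) * x₂ * y₂ * u ^ 2 + ((-9 : ℂ) / 4) * x₂ * y₂ ^ 2 * u + ((-19 : ℂ) / 8) * x₂ * y₂ ^ 3 + ((3 : ℂ) / 16) * x₂ ^ 2 * u ^ 2 + ((9 : ℂ) / 4) * x₂ ^ 2 * y₂ * u + ((87 : ℂ) / 16) * x₂ ^ 2 * y₂ ^ 2 + ((-1 : ℂ) / 8) * x₂ ^ 3 * y₂ + ((-15 : ℂ) / 16) * x₁ * y₂ ^ 2 * u + ((15 : ℂ) / 8) * x₁ * y₂ ^ 3 + ((-5 :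 ℂ) / 16) * x₁ ^ 2 * y₂ * u + ((-25 : ℂ) / 16) * x₁ ^ 2 * y₂ ^ 2 + ((-3 : ℂ) / 8) * x₁ ^ 3 * u + ((-43 : ℂ) / 16) * x₁ ^ 3 * y₂ + ((29 : ℂ) / 32) * x₁ ^ 3 * x₂ + ((3 : ℂ) / 32) * u ^ 3 + ((-29 : ℂ) / 32) * y₂ * u ^ 2 + ((19 : ℂ) / 8) * y₂ ^ 2 * u + ((5 : ℂ) / 8) * y₂ ^ 3 + ((-3 : ℂ) / 16) * x₂ * u ^ 2 + ((-3 : ℂ) / 2) * x₂ * y₂ * u + ((-57 : ℂ) / 16) * x₂ * y₂ ^ 2 + ((9 : ℂ) / 16) * x₂ ^ 2 * u + ((29 : ℂ) / 8) * x₂ ^ 2 * y₂ + ((-1 : ℂ) / 32) * x₂ ^ 3 + ((-15 : ℂ) / 32) * x₁ * y₂ * u + ((15 : ℂ) / 8) * x₁ * y₂ ^ 2 + ((-1 : ℂ) / 16) * x₁ ^ 2 * u + ((-25 : ℂ) / 32) * x₁ ^ 2 * y₂ + ((-21 : ℂ) / 32) * x₁ ^ 3 + ((-7 : ℂ) / 32)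 * u ^ 2 + ((11 : ℂ) / 8) * y₂ * u + ((25 : ℂ) / 16) * y₂ ^ 2 + ((-3 : ℂ) / 8) * x₂ * u + ((-19 : ℂ) / 8) * x₂ * y₂ + ((29 : ℂ) / 32) * x₂ ^ 2 + ((-3 : ℂ) / 32) * x₁ * u + ((15 : ℂ) / 16) * x₁ * y₂ + ((-5 : ℂ) / 32) * x₁ ^ 2 + ((5 : ℂ) / 16) * u + ((5 : ℂ) / 4) * y₂ + ((-19 : ℂ) / 32) * x₂ + ((3 : ℂ) / 16) * x₁ + ((11 : ℂ) / 32)) * h1 +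
    (((-1 : ℂ) / 32) * x₁ ^ 8 * y₂ ^ 4 * u ^ 2 + ((-1 : ℂ) / 32) * x₁ ^ 9 * y₂ ^ 4 * u + ((-1 : ℂ) / 32) * x₁ ^ 10 * y₂ ^ 4 + ((-1 : ℂ) / 32) * x₁ ^ 7 * y₂ ^ 4 * u ^ 2 + ((-1 : ℂ) / 8) * x₁ ^ 8 * y₂ ^ 3 * u ^ 2 + ((-5 : ℂ) / 32) * x₁ ^ 8 * y₂ ^ 4 * u + ((-1 : ℂ) / 8) * x₁ ^ 9 * y₂ ^ 3 * u + ((-3 : ℂ) / 32) * x₁ ^ 9 * y₂ ^ 4 + ((-1 : ℂ) / 8) * x₁ ^ 10 * y₂ ^ 3 + ((-1 : ℂ) / 32) * x₁ ^ 6 * y₂ ^ 4 * u ^ 2 + ((-1 : ℂ) / 8) * x₁ ^ 7 * y₂ ^ 3 * u ^ 2 + ((-3 : ℂ) / 32) * x₁ ^ 7 * y₂ ^ 4 * u + ((-3 : ℂ) / 16) * x₁ ^ 8 * y₂ ^ 2 * u ^ 2 + ((-5 : ℂ) / 8) * x₁ ^ 8 * y₂ ^ 3 * u + ((-9 : ℂ)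 / 32) * x₁ ^ 8 * y₂ ^ 4 + ((-3 : ℂ) / 16) * x₁ ^ 9 * y₂ ^ 2 * u + ((-3 : ℂ) / 8) * x₁ ^ 9 * y₂ ^ 3 + ((-3 : ℂ) / 16) * x₁ ^ 10 * y₂ ^ 2 + ((1 : ℂ) / 16) * x₁ ^ 5 * y₂ ^ 4 * u ^ 2 + ((-1 : ℂ) / 8) * x₁ ^ 6 * y₂ ^ 3 * u ^ 2 + ((1 : ℂ) / 16) * x₁ ^ 6 * y₂ ^ 4 * u + ((-3 : ℂ) / 16) * x₁ ^ 7 * y₂ ^ 2 * u ^ 2 + ((-3 : ℂ) / 8) * x₁ ^ 7 * y₂ ^ 3 * u + ((1 : ℂ) / 16) * x₁ ^ 7 * y₂ ^ 4 + ((-1 : ℂ) / 8) * x₁ ^ 8 * y₂ * u ^ 2 + ((-15 : ℂ) / 16) * x₁ ^ 8 * y₂ ^ 2 * u + ((-9 : ℂ) / 8) * x₁ ^ 8 * y₂ ^ 3 + ((-1 : ℂ) / 8) * x₁ ^ 9 * y₂ * u + ((-9 : ℂ) / 16) * x₁ ^ 9 * y₂ ^ 2 + ((-1 : ℂ) / 8)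 * x₁ ^ 10 * y₂ + ((1 : ℂ) / 16) * x₁ ^ 4 * y₂ ^ 4 * u ^ 2 + ((1 : ℂ) / 4) * x₁ ^ 5 * y₂ ^ 3 * u ^ 2 + ((3 : ℂ) / 16) * x₁ ^ 5 * y₂ ^ 4 * u + ((-3 : ℂ) / 16) * x₁ ^ 6 * y₂ ^ 2 * u ^ 2 + ((1 : ℂ) / 4) * x₁ ^ 6 * y₂ ^ 3 * u + ((1 : ℂ) / 8) * x₁ ^ 6 * y₂ ^ 4 + ((-1 : ℂ) / 8) * x₁ ^ 7 * y₂ * u ^ 2 + ((-9 : ℂ) / 16) * x₁ ^ 7 * y₂ ^ 2 * u + ((1 : ℂ) / 4) * x₁ ^ 7 * y₂ ^ 3 + ((-1 : ℂ) / 32) * x₁ ^ 8 * u ^ 2 + ((-5 : ℂ) / 8) * x₁ ^ 8 * y₂ * u + ((-27 : ℂ) / 16) * x₁ ^ 8 * y₂ ^ 2 + ((-1 : ℂ) / 32) * x₁ ^ 9 * u + ((-3 : ℂ) / 8) * x₁ ^ 9 * y₂ + ((-1 : ℂ) / 32) * x₁ ^ 10 + ((1 : ℂ) / 16) * x₁ ^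 3 * y₂ ^ 4 * u ^ 2 + ((1 : ℂ) / 4) * x₁ ^ 4 * y₂ ^ 3 * u ^ 2 + ((1 : ℂ) / 16) * x₁ ^ 4 * y₂ ^ 4 * u + ((3 : ℂ) / 8) * x₁ ^ 5 * y₂ ^ 2 * u ^ 2 + ((3 : ℂ) / 4) * x₁ ^ 5 * y₂ ^ 3 * u + ((1 : ℂ) / 4) * x₁ ^ 5 * y₂ ^ 4 + ((-1 : ℂ) / 8) * x₁ ^ 6 * y₂ * u ^ 2 + ((3 : ℂ) / 8) * x₁ ^ 6 * y₂ ^ 2 * u + ((1 : ℂ) / 2) * x₁ ^ 6 * y₂ ^ 3 + ((-1 : ℂ) / 32) * x₁ ^ 7 * u ^ 2 + ((-3 : ℂ) / 8) * x₁ ^ 7 * y₂ * u + ((3 : ℂ) / 8) * x₁ ^ 7 * y₂ ^ 2 + ((-5 : ℂ) / 32) * x₁ ^ 8 * u + ((-9 : ℂ) / 8) * x₁ ^ 8 * y₂ + ((-3 : ℂ) / 32) * x₁ ^ 9 + ((-1 : ℂ) / 32) * x₁ ^ 2 * y₂ ^ 4 * u ^ 2 + ((1 : ℂ) / 4) * x₁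 ^ 3 * y₂ ^ 3 * u ^ 2 + ((-5 : ℂ) / 32) * x₁ ^ 3 * y₂ ^ 4 * u + ((3 : ℂ) / 8) * x₁ ^ 4 * y₂ ^ 2 * u ^ 2 + ((1 : ℂ) / 4) * x₁ ^ 4 * y₂ ^ 3 * u + ((-7 : ℂ) / 32) * x₁ ^ 4 * y₂ ^ 4 + ((1 : ℂ) / 4) * x₁ ^ 5 * y₂ * u ^ 2 + ((9 : ℂ) / 8) * x₁ ^ 5 * y₂ ^ 2 * u + (1 : ℂ) * x₁ ^ 5 * y₂ ^ 3 + ((-1 : ℂ) / 32) * x₁ ^ 6 * u ^ 2 + ((1 : ℂ) / 4) * x₁ ^ 6 * y₂ * u + ((3 : ℂ) / 4) * x₁ ^ 6 * y₂ ^ 2 + ((-3 : ℂ) / 32) * x₁ ^ 7 * u + ((1 : ℂ) / 4) * x₁ ^ 7 * y₂ + ((-9 : ℂ) / 32) * x₁ ^ 8 + ((-1 : ℂ) / 32) * x₁ * y₂ ^ 4 * u ^ 2 + ((-1 : ℂ) / 8) * x₁ ^ 2 * y₂ ^ 3 * u ^ 2 + ((-1 : ℂ) / 32) * x₁ ^ 2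 * y₂ ^ 4 * u + ((3 : ℂ) / 8) * x₁ ^ 3 * y₂ ^ 2 * u ^ 2 + ((-5 : ℂ) / 8) * x₁ ^ 3 * y₂ ^ 3 * u + ((-1 : ℂ) / 32) * x₁ ^ 3 * y₂ ^ 4 + ((1 : ℂ) / 4) * x₁ ^ 4 * y₂ * u ^ 2 + ((3 : ℂ) / 8) * x₁ ^ 4 * y₂ ^ 2 * u + ((-7 : ℂ) / 8) * x₁ ^ 4 * y₂ ^ 3 + ((1 : ℂ) / 16) * x₁ ^ 5 * u ^ 2 + ((3 : ℂ) / 4) * x₁ ^ 5 * y₂ * u + ((3 : ℂ) / 2) * x₁ ^ 5 * y₂ ^ 2 + ((1 : ℂ) / 16) * x₁ ^ 6 * u + ((1 : ℂ) / 2) * x₁ ^ 6 * y₂ + ((1 : ℂ) / 16) * x₁ ^ 7 + ((-1 : ℂ) / 32) * y₂ ^ 4 * u ^ 2 + ((-1 : ℂ) / 8) * x₁ * y₂ ^ 3 * u ^ 2 + ((1 : ℂ) / 32) * x₁ * y₂ ^ 4 * u + ((-3 : ℂ) / 16) * x₁ ^ 2 * y₂ ^ 2 * u ^ 2 + ((-1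 : ℂ) / 8) * x₁ ^ 2 * y₂ ^ 3 * u + ((-3 : ℂ) / 32) * x₁ ^ 2 * y₂ ^ 4 + ((1 : ℂ) / 4) * x₁ ^ 3 * y₂ * u ^ 2 + ((-15 : ℂ) / 16) * x₁ ^ 3 * y₂ ^ 2 * u + ((-1 : ℂ) / 8) * x₁ ^ 3 * y₂ ^ 3 + ((1 : ℂ) / 16) * x₁ ^ 4 * u ^ 2 + ((1 : ℂ) / 4) * x₁ ^ 4 * y₂ * u + ((-21 : ℂ) / 16) * x₁ ^ 4 * y₂ ^ 2 + ((3 : ℂ) / 16) * x₁ ^ 5 * u + (1 : ℂ) * x₁ ^ 5 * y₂ + ((1 : ℂ) / 8) * x₁ ^ 6 + ((-1 : ℂ) / 8) * y₂ ^ 3 * u ^ 2 + ((1 : ℂ) / 8) * y₂ ^ 4 * u + ((-3 : ℂ) / 16) * x₁ * y₂ ^ 2 * u ^ 2 + ((1 : ℂ) / 8) * x₁ * y₂ ^ 3 * u + ((1 : ℂ) / 16) * x₁ * y₂ ^ 4 + ((-1 : ℂ) / 8) * x₁ ^ 2 * y₂ * u ^ 2 + ((-3 : ℂ) / 16) * x₁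 ^ 2 * y₂ ^ 2 * u + ((-3 : ℂ) / 8) * x₁ ^ 2 * y₂ ^ 3 + ((1 : ℂ) / 16) * x₁ ^ 3 * u ^ 2 + ((-5 : ℂ) / 8) * x₁ ^ 3 * y₂ * u + ((-3 : ℂ) / 16) * x₁ ^ 3 * y₂ ^ 2 + ((1 : ℂ) / 16) * x₁ ^ 4 * u + ((-7 : ℂ) / 8) * x₁ ^ 4 * y₂ + ((1 : ℂ) / 4) * x₁ ^ 5 + ((-3 : ℂ) / 16) * y₂ ^ 2 * u ^ 2 + ((1 : ℂ) / 2) * y₂ ^ 3 * u + ((-1 : ℂ) / 8) * y₂ ^ 4 + ((-1 : ℂ) / 8) * x₁ * y₂ * u ^ 2 + ((3 : ℂ) / 16) * x₁ * y₂ ^ 2 * u + ((1 : ℂ) / 4) * x₁ * y₂ ^ 3 + ((-1 : ℂ) / 32) * x₁ ^ 2 * u ^ 2 + ((-1 : ℂ) / 8) * x₁ ^ 2 * y₂ * u + ((-9 : ℂ) / 16) * x₁ ^ 2 * y₂ ^ 2 + ((-5 : ℂ) / 32) * x₁ ^ 3 * u + ((-1 : ℂ) / 8) * x₁ ^ 3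 * y₂ + ((-7 : ℂ) / 32) * x₁ ^ 4 + ((-1 : ℂ) / 8) * y₂ * u ^ 2 + ((3 : ℂ) / 4) * y₂ ^ 2 * u + ((-1 : ℂ) / 2) * y₂ ^ 3 + ((-1 : ℂ) / 32) * x₁ * u ^ 2 + ((1 : ℂ) / 8) * x₁ * y₂ * u + ((3 : ℂ) / 8) * x₁ * y₂ ^ 2 + ((-1 : ℂ) / 32) * x₁ ^ 2 * u + ((-3 : ℂ) / 8) * x₁ ^ 2 * y₂ + ((-1 : ℂ) / 32) * x₁ ^ 3 + ((-1 : ℂ) / 32) * u ^ 2 + ((1 : ℂ) / 2) * y₂ * u + ((-3 : ℂ) / 4) * y₂ ^ 2 + ((1 : ℂ) / 32) * x₁ * u + ((1 : ℂ) / 4) * x₁ * y₂ + ((-3 : ℂ) / 32) * x₁ ^ 2 + ((1 : ℂ) / 8) * u + ((-1 : ℂ) / 2) * y₂ + ((1 : ℂ) / 16) * x₁ + ((-1 : ℂ) / 8)) * h2 +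
    (((-1 : ℂ) / 32) * x₁ ^ 6 * y₂ ^ 4 * u ^ 2 + ((-1 : ℂ) / 32) * x₁ ^ 7 * y₂ ^ 4 * u + ((-1 : ℂ) / 32) * x₁ ^ 8 * y₂ ^ 4 + ((-1 : ℂ) / 8) * x₁ ^ 6 * y₂ ^ 3 * u ^ 2 + ((-1 : ℂ) / 8) * x₁ ^ 6 * y₂ ^ 4 * u + ((-1 : ℂ) / 8) * x₁ ^ 7 * y₂ ^ 3 * u + ((-1 : ℂ) / 16) * x₁ ^ 7 * y₂ ^ 4 + ((-1 : ℂ) / 8) * x₁ ^ 8 * y₂ ^ 3 + ((1 : ℂ) / 16) * x₁ ^ 5 * y₂ ^ 4 * u + ((-3 : ℂ) / 16) * x₁ ^ 6 * y₂ ^ 2 * u ^ 2 + ((-1 : ℂ) / 2) * x₁ ^ 6 * y₂ ^ 3 * u + ((-3 : ℂ) / 16) * x₁ ^ 6 * y₂ ^ 4 + ((-3 : ℂ) / 16) * x₁ ^ 7 * y₂ ^ 2 * u + ((-1 : ℂ) / 4) * x₁ ^ 7 * y₂ ^ 3 + ((-3 : ℂ) / 16) * x₁ ^ 8 * y₂ ^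 2 + ((1 : ℂ) / 16) * x₁ ^ 3 * y₂ ^ 4 * u ^ 2 + ((1 : ℂ) / 8) * x₁ ^ 4 * y₂ ^ 4 * u + ((1 : ℂ) / 4) * x₁ ^ 5 * y₂ ^ 3 * u + ((5 : ℂ) / 16) * x₁ ^ 5 * y₂ ^ 4 + ((-1 : ℂ) / 8) * x₁ ^ 6 * y₂ * u ^ 2 + ((-3 : ℂ) / 4) * x₁ ^ 6 * y₂ ^ 2 * u + ((-3 : ℂ) / 4) * x₁ ^ 6 * y₂ ^ 3 + ((-1 : ℂ) / 8) * x₁ ^ 7 * y₂ * u + ((-3 : ℂ) / 8) * x₁ ^ 7 * y₂ ^ 2 + ((-1 : ℂ) / 8) * x₁ ^ 8 * y₂ + ((1 : ℂ) / 32) * x₂ ^ 2 * y₂ ^ 3 * u ^ 3 + ((1 : ℂ) / 4) * x₁ ^ 3 * y₂ ^ 3 * u ^ 2 + ((1 : ℂ) / 2) * x₁ ^ 4 * y₂ ^ 3 * u + ((3 : ℂ) / 8) * x₁ ^ 5 * y₂ ^ 2 * u + ((5 : ℂ) / 4) * x₁ ^ 5 * y₂ ^ 3 + ((-1 : ℂ)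 / 32) * x₁ ^ 6 * u ^ 2 + ((-1 : ℂ) / 2) * x₁ ^ 6 * y₂ * u + ((-9 : ℂ) / 8) * x₁ ^ 6 * y₂ ^ 2 + ((-1 : ℂ) / 32) * x₁ ^ 7 * u + ((-1 : ℂ) / 4) * x₁ ^ 7 * y₂ + ((-1 : ℂ) / 32) * x₁ ^ 8 + ((-1 : ℂ) / 16) * x₂ * y₂ ^ 3 * u ^ 3 + ((3 : ℂ) / 32) * x₂ ^ 2 * y₂ ^ 2 * u ^ 3 + ((3 : ℂ) / 16) * x₂ ^ 2 * y₂ ^ 3 * u ^ 2 + ((-1 : ℂ) / 16) * x₁ ^ 2 * y₂ ^ 4 * u + ((3 : ℂ) / 8) * x₁ ^ 3 * y₂ ^ 2 * u ^ 2 + ((-1 : ℂ) / 16) * x₁ ^ 3 * y₂ ^ 4 + ((3 : ℂ) / 4) * x₁ ^ 4 * y₂ ^ 2 * u + ((1 : ℂ) / 4) * x₁ ^ 5 * y₂ * u + ((15 : ℂ) / 8) * x₁ ^ 5 * y₂ ^ 2 + ((-1 : ℂ) / 8) * x₁ ^ 6 * u + ((-3 : ℂ) / 4) * x₁ ^ 6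 * y₂ + ((-1 : ℂ) / 16) * x₁ ^ 7 + ((1 : ℂ) / 32) * y₂ ^ 3 * u ^ 3 + ((-1 : ℂ) / 32) * y₂ ^ 4 * u ^ 2 + ((-1 : ℂ) / 4) * x₂ * y₂ ^ 2 * u ^ 3 + ((3 : ℂ) / 32) * x₂ ^ 2 * y₂ * u ^ 3 + ((9 : ℂ) / 16) * x₂ ^ 2 * y₂ ^ 2 * u ^ 2 + ((9 : ℂ) / 16) * x₂ ^ 2 * y₂ ^ 3 * u + ((-1 : ℂ) / 32) * x₂ ^ 3 * y₂ ^ 3 + ((-3 : ℂ) / 32) * x₁ * y₂ ^ 4 * u + ((-1 : ℂ) / 4) * x₁ ^ 2 * y₂ ^ 3 * u + ((-5 : ℂ) / 32) * x₁ ^ 2 * y₂ ^ 4 + ((1 : ℂ) / 4) * x₁ ^ 3 * y₂ * u ^ 2 + ((-1 : ℂ) / 4) * x₁ ^ 3 * y₂ ^ 3 + ((1 : ℂ) / 2) * x₁ ^ 4 * y₂ * u + ((1 : ℂ) / 16) * x₁ ^ 5 * u + ((5 : ℂ) / 4) * x₁ ^ 5 * y₂ + ((-3 : ℂ) / 16)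 * x₁ ^ 6 + ((5 : ℂ) / 32) * y₂ ^ 2 * u ^ 3 + ((-5 : ℂ) / 16) * y₂ ^ 3 * u ^ 2 + ((1 : ℂ) / 8) * y₂ ^ 4 * u + ((-5 : ℂ) / 16) * x₂ * y₂ * u ^ 3 + ((-3 : ℂ) / 8) * x₂ * y₂ ^ 2 * u ^ 2 + ((3 : ℂ) / 16) * x₂ * y₂ ^ 3 * u + ((1 : ℂ) / 32) * x₂ ^ 2 * u ^ 3 + ((9 : ℂ) / 16) * x₂ ^ 2 * y₂ * u ^ 2 + ((27 : ℂ) / 16) * x₂ ^ 2 * y₂ ^ 2 * u + ((7 : ℂ) / 8) * x₂ ^ 2 * y₂ ^ 3 + ((-3 : ℂ) / 32) * x₂ ^ 3 * y₂ ^ 2 + ((-3 : ℂ) / 8) * x₁ * y₂ ^ 3 * u + ((3 : ℂ) / 16) * x₁ * y₂ ^ 4 + ((-3 : ℂ) / 8) * x₁ ^ 2 * y₂ ^ 2 * u + ((-5 : ℂ) / 8) * x₁ ^ 2 * y₂ ^ 3 + ((1 : ℂ) / 16) * x₁ ^ 3 * u ^ 2 + ((-3 : ℂ) / 8) * x₁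 ^ 3 * y₂ ^ 2 + ((1 : ℂ) / 8) * x₁ ^ 4 * u + ((5 : ℂ) / 16) * x₁ ^ 5 + ((11 : ℂ) / 32) * y₂ * u ^ 3 + ((-9 : ℂ) / 8) * y₂ ^ 2 * u ^ 2 + ((7 : ℂ) / 8) * y₂ ^ 3 * u + ((-1 : ℂ) / 8) * y₂ ^ 4 + ((-1 : ℂ) / 8) * x₂ * u ^ 3 + ((-3 : ℂ) / 4) * x₂ * y₂ * u ^ 2 + ((-9 : ℂ) / 16) * x₂ * y₂ ^ 2 * u + ((9 : ℂ) / 32) * x₂ * y₂ ^ 3 + ((3 : ℂ) / 16) * x₂ ^ 2 * u ^ 2 + ((27 : ℂ) / 16) * x₂ ^ 2 * y₂ * u + ((43 : ℂ) / 16) * x₂ ^ 2 * y₂ ^ 2 + ((-3 : ℂ) / 32) * x₂ ^ 3 * y₂ + ((-9 : ℂ) / 16) * x₁ * y₂ ^ 2 * u + ((3 : ℂ) / 4) * x₁ * y₂ ^ 3 + ((-1 : ℂ) / 4) * x₁ ^ 2 * y₂ * u + ((-15 : ℂ) / 16) * x₁ ^ 2 * y₂ ^ 2 + ((-1 : ℂ)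 / 4) * x₁ ^ 3 * y₂ + ((7 : ℂ) / 32) * u ^ 3 + ((-11 : ℂ) / 16) * y₂ * u ^ 2 + ((3 : ℂ) / 8) * y₂ ^ 2 * u + ((1 : ℂ) / 4) * y₂ ^ 3 + ((-3 : ℂ) / 8) * x₂ * u ^ 2 + ((-27 : ℂ) / 16) * x₂ * y₂ * u + ((-27 : ℂ) / 32) * x₂ * y₂ ^ 2 + ((9 : ℂ) / 16) * x₂ ^ 2 * u + ((11 : ℂ) / 4) * x₂ ^ 2 * y₂ + ((-1 : ℂ) / 32) * x₂ ^ 3 + ((-3 : ℂ) / 8) * x₁ * y₂ * u + ((9 : ℂ) / 8) * x₁ * y₂ ^ 2 + ((-1 : ℂ) / 16) * x₁ ^ 2 * u + ((-5 : ℂ) / 8) * x₁ ^ 2 * y₂ + ((-1 : ℂ) / 16) * x₁ ^ 3 + ((5 : ℂ) / 32) * u ^ 2 + ((7 : ℂ) / 8) * y₂ * u + ((-3 : ℂ) / 4) * y₂ ^ 2 + ((-15 : ℂ) / 16) * x₂ * u + ((-85 : ℂ) / 32) * x₂ * y₂ + ((15 : ℂ) / 16) * x₂ ^ 2 + ((-3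 : ℂ) / 32) * x₁ * u + ((3 : ℂ) / 4) * x₁ * y₂ + ((-5 : ℂ) / 32) * x₁ ^ 2 + ((5 : ℂ) / 4) * u + ((1 : ℂ) / 2) * y₂ + ((-49 : ℂ) / 32) * x₂ + ((3 : ℂ) / 16) * x₁ + ((15 : ℂ) / 8)) * h3

end cubicCerts

/-- Monic quartic over `ℂ[u]` killing `x₁` on `cubicW`. [folklore] -/
def cubicPolyX₁ : Polynomial (MvPolynomial (Fin 1) ℂ) :=
  Polynomial.X ^ 4 +
      Polynomial.C (C (-1 : ℂ) * X 0 + C (-2 : ℂ)) * Polynomial.X ^ 3 +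
      Polynomial.C (C (-2 : ℂ)) * Polynomial.X ^ 2 +
      Polynomial.C (C (-3 : ℂ)) * Polynomial.X +
      Polynomial.C (C (1 : ℂ) * X 0 + C (-2 : ℂ))

/-- Monic quartic over `ℂ[u]` killing `x₂` on `cubicW`. [folklore] -/
def cubicPolyX₂ : Polynomial (MvPolynomial (Fin 1) ℂ) :=
  Polynomial.X ^ 4 +
      Polynomial.C (C (-1 : ℂ) * X 0 ^ 3 + C (-6 : ℂ) * X 0 ^ 2 + C (-18 : ℂ) * X 0 + C (-29 : ℂ)) * Polynomial.X ^ 3 +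
      Polynomial.C (C (3 : ℂ) * X 0 ^ 3 + C (6 : ℂ) * X 0 ^ 2 + C (12 : ℂ) * X 0 + C (19 : ℂ)) * Polynomial.X ^ 2 +
      Polynomial.C (C (-3 : ℂ) * X 0 ^ 3 + C (6 : ℂ) * X 0 ^ 2 + C (-6 : ℂ) * X 0 + C (-15 : ℂ)) * Polynomial.X +
      Polynomial.C (C (1 : ℂ) * X 0 ^ 3 + C (-6 : ℂ) * X 0 ^ 2 + C (12 : ℂ) * X 0 + C (-8 : ℂ))

/-- Monic quartic over `ℂ[u]` killing `y₁` on `cubicW`. [folklore] -/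
def cubicPolyY₁ : Polynomial (MvPolynomial (Fin 1) ℂ) :=
  Polynomial.X ^ 4 +
      Polynomial.C (C ((-3 : ℂ) / 4) * X 0 + C ((7 : ℂ) / 4)) * Polynomial.X ^ 3 +
      Polynomial.C (C ((-3 : ℂ) / 4) * X 0 + C ((1 : ℂ) / 4)) * Polynomial.X ^ 2 +
      Polynomial.C (C ((-1 : ℂ) / 4) * X 0 + C ((5 : ℂ) / 4)) * Polynomial.X +
      Polynomial.C (C ((-1 : ℂ) / 4) * X 0 + C ((-1 : ℂ) / 4))

/-- Monic quartic over `ℂ[u]` killing `y₂` on `cubicW`. [folklore] -/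
def cubicPolyY₂ : Polynomial (MvPolynomial (Fin 1) ℂ) :=
  Polynomial.X ^ 4 +
      Polynomial.C (C ((-9 : ℂ) / 4) * X 0 + C ((1 : ℂ) / 4)) * Polynomial.X ^ 3 +
      Polynomial.C (C ((3 : ℂ) / 2) * X 0 ^ 2 + C ((-3 : ℂ) / 2) * X 0 + C ((5 : ℂ) / 2)) * Polynomial.X ^ 2 +
      Polynomial.C (C ((-1 : ℂ) / 4) * X 0 ^ 3 + C ((3 : ℂ) / 2) * X 0 ^ 2 + C ((-3 : ℂ) / 4) * X 0 + C (2 : ℂ)) * Polynomial.X +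
      Polynomial.C (C ((-1 : ℂ) / 4) * X 0 ^ 3 + C ((-3 : ℂ) / 2) * X 0 + C ((-7 : ℂ) / 4))

/-- `cubicPolyX₁` is monic. [folklore] -/
theorem monic_cubicPolyX₁ : cubicPolyX₁.Monic := by unfold cubicPolyX₁; monicity!
/-- `cubicPolyX₂` is monic. [folklore] -/
theorem monic_cubicPolyX₂ : cubicPolyX₂.Monic := by unfold cubicPolyX₂; monicity!
/-- `cubicPolyY₁` is monic. [folklore] -/
theorem monic_cubicPolyY₁ : cubicPolyY₁.Monic := by unfold cubicPolyY₁; monicity!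
/-- `cubicPolyY₂` is monic. [folklore] -/
theorem monic_cubicPolyY₂ : cubicPolyY₂.Monic := by unfold cubicPolyY₂; monicity!

/-- `cubicW` has dimension `≤ 1 < 2`: all four coordinates are integral over `ℂ[x₁ + y₁ + y₂]`
(explicit monic quartics `cubicPolyX₁ … cubicPolyY₂`, certificates `cubicW_cert_…`). [folklore] -/
theorem zariskiDim_cubicW : zariskiDim ℂ cubicW < 2 := by
  have hdim : ringKrullDim (MvPolynomial (Fin 1) ℂ) = (1 : ℕ) := by
    rw [MvPolynomial.ringKrullDim_of_isNoetherianRing, ringKrullDim_eq_zero_of_field, zero_add,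
      Nat.card_eq_fintype_card, Fintype.card_fin]
  refine lt_of_le_of_lt ?_ (lt_of_eq_of_lt hdim (by decide))
  refine zariskiDim_le_of_integral_gens cubicW
    (fun _ : Fin 1 => X (Sum.inl 0) + X (Sum.inr 0) + X (Sum.inr 1)) ?_
  rintro (i | i) <;> fin_cases i
  · refine ⟨cubicPolyX₁, monic_cubicPolyX₁, fun w hw => ?_⟩
    obtain ⟨h1, h2, h3⟩ := hw
    simp only [cubicPolyX₁, Polynomial.eval_map, Polynomial.eval₂_add, Polynomial.eval₂_mul,
      Polynomial.eval₂_pow, Polynomial.eval₂_X, Polynomial.eval₂_C, MvPolynomial.eval_C,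
      MvPolynomial.eval_X, map_add, map_mul, Fin.zero_eta, Fin.isValue]
    linear_combination cubicW_cert_x₁ (w (Sum.inl 0)) (w (Sum.inl 1)) (w (Sum.inr 0))
      (w (Sum.inr 1)) _ rfl h1 h2 h3
  · refine ⟨cubicPolyX₂, monic_cubicPolyX₂, fun w hw => ?_⟩
    obtain ⟨h1, h2, h3⟩ := hw
    simp only [cubicPolyX₂, Polynomial.eval_map, Polynomial.eval₂_add, Polynomial.eval₂_mul,
      Polynomial.eval₂_pow, Polynomial.eval₂_X, Polynomial.eval₂_C, MvPolynomial.eval_C,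
      MvPolynomial.eval_X, map_add, map_mul, map_pow, Fin.mk_one, Fin.isValue]
    linear_combination cubicW_cert_x₂ (w (Sum.inl 0)) (w (Sum.inl 1)) (w (Sum.inr 0))
      (w (Sum.inr 1)) _ rfl h1 h2 h3
  · refine ⟨cubicPolyY₁, monic_cubicPolyY₁, fun w hw => ?_⟩
    obtain ⟨h1, h2, h3⟩ := hw
    simp only [cubicPolyY₁, Polynomial.eval_map, Polynomial.eval₂_add, Polynomial.eval₂_mul,
      Polynomial.eval₂_pow, Polynomial.eval₂_X, Polynomial.eval₂_C, MvPolynomial.eval_C,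
      MvPolynomial.eval_X, map_add, map_mul, Fin.zero_eta, Fin.isValue]
    linear_combination cubicW_cert_y₁ (w (Sum.inl 0)) (w (Sum.inl 1)) (w (Sum.inr 0))
      (w (Sum.inr 1)) _ rfl h1 h2 h3
  · refine ⟨cubicPolyY₂, monic_cubicPolyY₂, fun w hw => ?_⟩
    obtain ⟨h1, h2, h3⟩ := hw
    simp only [cubicPolyY₂, Polynomial.eval_map, Polynomial.eval₂_add, Polynomial.eval₂_mul,
      Polynomial.eval₂_pow, Polynomial.eval₂_X, Polynomial.eval₂_C, MvPolynomial.eval_C,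
      MvPolynomial.eval_X, map_add, map_mul, map_pow, Fin.mk_one, Fin.isValue]
    linear_combination cubicW_cert_y₂ (w (Sum.inl 0)) (w (Sum.inl 1)) (w (Sum.inr 0))
      (w (Sum.inr 1)) _ rfl h1 h2 h3

/-- `(t, t³)` is ℚ-linearly independent at every solution `t ≠ 0` of `(1−t)eᵗ = 1+t`: a relation
would make `t² ∈ ℚ`, so `t ∈ ℚ̄ ∖ {0}` with `eᵗ = (1+t)/(1−t) ∈ ℚ̄`, contradicting Hermite–Lindemann
(`transcendental_exp_holds`, PROVED in the tree). [folklore] -/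
theorem linearIndependent_pair_cube_of_cayley {t : ℂ} (ht : t ≠ 0)
    (hC : (1 - t) * Complex.exp t = 1 + t) : LinearIndependent ℚ ![t, t ^ 3] := by
  rw [LinearIndependent.pair_iff]
  intro s r hsr
  rw [Rat.smul_def, Rat.smul_def] at hsr
  by_cases hr : r = 0
  · subst hr
    have : (s : ℂ) * t = 0 := by simpa using hsr
    rcases mul_eq_zero.1 this with h' | h'
    · exact ⟨by exact_mod_cast h', rfl⟩
    · exact absurd h' ht
  · exfalso
    have hr' : (r : ℂ) ≠ 0 := by exact_mod_cast hr
    have h2 : t ^ 2 = ((-s / r : ℚ) : ℂ) := by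
      have h' : t * ((s : ℂ) + r * t ^ 2) = 0 := by linear_combination hsr
      rcases mul_eq_zero.1 h' with h'' | h''
      · exact absurd h'' ht
      · push_cast
        field_simp
        linear_combination h''
    have halg : IsAlgebraic ℚ t := by
      refine IsAlgebraic.of_pow two_pos ?_
      rw [h2]
      exact isAlgebraic_algebraMap _
    have h1t : (1 - t) ≠ 0 := by
      intro h1t
      have : (1 + t) = 0 := by rw [← hC, h1t, zero_mul]
      have ht1 : t = 1 := by linear_combination (-1 : ℂ) * h1t
      rw [ht1] at this
      norm_num at this
    have hexp : Complex.exp t = (1 + t) * (1 - t)⁻¹ := by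
      field_simp
      linear_combination hC
    have hexpalg : IsAlgebraic ℚ (Complex.exp t) := by
      rw [hexp]
      exact (isAlgebraic_one.add halg).mul (isAlgebraic_one.sub halg).inv
    exact transcendental_exp_holds halg ht hexpalg

/-- **Sparsity at `n = 2` settles the double-Cayley cubic atom**: SPARSITY(2) implies that
`(1−t)eᵗ = 1+t` and `(1−t³)e^{t³} = 1+t³` have only finitely many common solutions `t ≠ 0`
(§3b: exact hits `‖π²M³/2 − 1/2 + 1/(π²M) + O(M⁻³)‖ = 0`, `M` odd). OPEN; each hit violates SC(2);
outside Shapiro's conjecture (non-linear frequency). [folklore] -/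
theorem cubicCayley_finite_of_sparsity
    (h : ∀ W : Set (Fin 2 ⊕ Fin 2 → ℂ), IsDefinedOver (⊥ : Subfield ℂ) W → zariskiDim ℂ W < 2 →
      (indepExpPoints W).Finite) :
    Set.Finite {t : ℂ | t ≠ 0 ∧ (1 - t) * Complex.exp t = 1 + t ∧
      (1 - t ^ 3) * Complex.exp (t ^ 3) = 1 + t ^ 3} := by
  have hfin := h cubicW isDefinedOver_cubicW zariskiDim_cubicW
  let m : ℂ → (Fin 2 → ℂ) := fun t => ![t, t ^ 3]
  have hm : Function.Injective m := fun a b hab => by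
    have := congrFun hab 0
    simpa [m] using this
  refine (hfin.preimage hm.injOn).subset ?_
  rintro t ⟨ht, hC, hG⟩
  refine ⟨linearIndependent_pair_cube_of_cayley ht hC, ?_, ?_, ?_⟩
  · simp [m]
  · simp only [m, Sum.elim_inl, Sum.elim_inr, Function.comp_apply, Matrix.cons_val_zero]
    linear_combination hC
  · simp only [m, Sum.elim_inl, Sum.elim_inr, Function.comp_apply, Matrix.cons_val_one,
      Matrix.cons_val_fin_one]
    linear_combination hG



end

end Literature.NumberTheory.Transcendental
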